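import Literature.AlgebraicGeometry.DuqueFrancoVillaflor2023.FakeLinearCycleQuadraticForm
import Literature.AlgebraicGeometry.DuqueFrancoVillaflor2025.JoinMilnorNumber
import Literature.AlgebraicGeometry.DuqueFrancoVillaflor2025.JoinArtinianGorenstein
import Literature.AlgebraicGeometry.HodgeTheory.CompleteIntersectionHilbertFunction
import Literature.RingTheory.Koszul.RegularSequenceFirstHomology
import HarnessLib

/-!
# Maclean's quadratic fundamental form of a join: Duque Franco–Villaflor, Thm. 1.3 eq. (eqQFFjoin) in general,
# and the algebraic content of Thm. 2.1 (the form is independent of the lifts, symmetric, `K[x]`-bilinear mod `J^F`)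

J. Duque Franco, R. Villaflor Loyola, *Periods of join algebraic cycles*, Ann. Sc. Norm. Super. Pisa (2025) =
arXiv:2312.17222 [DuqueFrancoVillaflor2025Join] (held text `paper:arxiv-2312.17222`, arXiv v1–v3 numbering;
Thm. 1.3 = Thm. 4.1 of arXiv v4, unchanged). Setting (§1, §3): `X_1 = {f(x) = 0} ⊂ ℙ^{k+1}`,
`X_2 = {g(y) = 0} ⊂ ℙ^{n−k−1}` smooth of degree `d`, `X = {f(x) + g(y) = 0} ⊂ ℙ^{n+1}`, cycles `Z_1`, `Z_2` and their
join `J(Z_1,Z_2)`; `J^F = ⟨∂F/∂x_i⟩`, `J^{F,λ} = (J^F : P_λ)`, `R^F = ℂ[x]/J^F` (Def. 2.2); Thm. 1.1: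
`P_{J(Z_1,Z_2)} = P_{Z_1}·P_{Z_2}` and `J^{f+g,[J(Z_1,Z_2)]} = J^{f,[Z_1]}S + J^{g,[Z_2]}S` (tree
`IsArtinianGorenstein.colon_join`). Verbatim:

> **Theorem 2.1 (Maclean).** The degree `r := d + (d−2)(n/2+1)` piece of the fundamental quadratic form is
> `q|_{Sym²(J^{F,λ}_d)}` where `q : Sym²(J^{F,λ}) → R^F/⟨P_λ⟩` is the bilinear form given by
> (eqQFF) `q(G,H) = Σ_{i=0}^{n+1} (H ∂Q_i/∂x_i − R_i ∂G/∂x_i)` where `G·P_λ = Σ_i Q_i ∂F/∂x_i` and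
> `H·P_λ = Σ_i R_i ∂F/∂x_i`.
> **Remark 2.3.** In particular `q(·, H) = 0` for any `H ∈ J^F`.
>
> **Theorem 1.3.** In the same context of Theorem 1.1 let us denote by
> `q : Sym²(J^{f+g,[J(Z_1,Z_2)]}) → R^{f+g}/⟨P_{Z_1}·P_{Z_2}⟩`, `q_1 : Sym²(J^{f,[Z_1]}) → R^f/⟨P_{Z_1}⟩`,
> `q_2 : Sym²(J^{g,[Z_2]}) → R^g/⟨P_{Z_2}⟩`, the bilinear forms (introduced in Theorem 2.1) associated to `J(Z_1,Z_2)`,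
> `Z_1` and `Z_2` respectively. Consider `G = A_1(x,y)G_1(x) + A_2(x,y)G_2(y) ∈ J^{f+g,[J(Z_1,Z_2)]}`,
> `H = B_1(x,y)H_1(x) + B_2(x,y)H_2(y) ∈ J^{f+g,[J(Z_1,Z_2)]}` with `G_1, H_1 ∈ J^{f,[Z_1]}`, `G_2, H_2 ∈ J^{g,[Z_2]}`.
> Then (eqQFFjoin) `q(G,H) = A_1B_1P_{Z_2} q_1(G_1,H_1) + A_2B_2P_{Z_1} q_2(G_2,H_2)`.
> In consequence for any degree `e ≥ 0` we have the following: (i) If `q_1` and `q_2` vanish in all degrees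
> `ℓ ≤ e`, then `q` vanishes in degree `e`. (ii) If `q` vanishes in degree `e`, then
> `q_1|_{Sym²(J^{f,[Z_1]}_ℓ)}·ℂ[x]_j = 0 ∈ R^f/⟨P_{Z_1}⟩` for all degrees `ℓ, j ≥ 0` such that `ℓ ≤ e`, `j ≤ 2(e−ℓ)`
> and `2(e−ℓ)−j ≤ (d−2)((n−k)/2)`. …
>
> *Proof of Theorem 1.3* (p. 11). Write `G_1·P_{Z_1} = Σ_{i=0}^{k+1} Q_i(x) ∂f/∂x_i`, `G_2·P_{Z_2} = Σ_j R_j(y) ∂g/∂y_j`,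
> `H_1·P_{Z_1} = Σ_i S_i(x) ∂f/∂x_i`, `H_2·P_{Z_2} = Σ_j T_j(y) ∂g/∂y_j`, then it follows by (eqQFF) that
> `q(G,H) = A_1B_1P_{Z_2} q_1(G_1,H_1) + A_2B_2 P_{Z_1} q_2(G_2,H_2) + B_1P_{Z_2}Σ_i (H_1Q_i − G_1S_i) ∂A_1/∂x_i
> + B_2P_{Z_1}Σ_j (H_2R_j − G_2T_j) ∂A_2/∂y_j`. Note that `Σ_i (H_1Q_i − G_1S_i) ∂f/∂x_i = 0` and
> `Σ_j (H_2R_j − G_2T_j) ∂g/∂y_j = 0`. Since `(∂f/∂x_0, …, ∂f/∂x_{k+1})` and `(∂g/∂y_0, …, ∂g/∂y_{n−k−1})` are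
> regular sequences, it follows by the exactness of the Koszul complex that `H_1Q_i − G_1S_i ∈ J^f` and
> `H_2R_j − G_2T_j ∈ J^g`, and so we obtain (eqQFFjoin).

## What this file proves (0 facts, 0 sorry), over any field `K`, at the level of polynomials

Maclean's expression is the tree's `macleanForm G H Q R = Σ_v (H ∂_v Q_v − R_v ∂_v G)`
(`DuqueFrancoVillaflor2023/FakeLinearCycleQuadraticForm.lean`), a polynomial depending on the chosen lifts
`Q, R`; `J^F = Ideal.span {∂_v F}`; "the partials have only trivial syzygies" is the tree's
`Literature.RingTheory.Koszul.HasKoszulSyzygies (∂_v F)_v` (`H_1` of their Koszul complex vanishes; Matsumura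
Thm. 16.5 (i) for regular sequences, file `RingTheory/Koszul/RegularSequenceFirstHomology.lean`).

**§1 — Theorem 2.1 (Maclean) / Remark 2.3, algebraic content, for ANY form `F` in finitely many variables**
(the cited transcendental input — that `q` IS the second fundamental form of `V_λ` — is not touched):
* `macleanForm_add_left/right` (bilinearity), `macleanForm_sub_macleanForm_left/right/swap` (change of a lift
  is `H·div(Q−Q')`, resp. `−Σ(R_v−R'_v)∂_vG`; swapping the arguments is the divergence of the syzygy `HQ − GR`);
* `sum_pderiv_koszulBoundary_mem` — the divergence of a trivial syzygy lies in `J^F` (symmetry of the Hessian),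
  hence (`sum_pderiv_mem_of_syzygy`) so does the divergence of every syzygy when `H_1 = 0`;
* **`macleanForm_sub_macleanForm_mem_of_lifts`** — `q(G,H)` modulo `J^F` does NOT depend on the lifts;
  **`macleanForm_sub_macleanForm_swap_mem`** — `q(G,H) ≡ q(H,G)`; **`macleanForm_mem_of_mem_span_pderiv`** —
  Rem. 2.3: `q(G,H) ∈ J^F + ⟨P_λ⟩` for `H ∈ J^F`, any lifts; **`macleanForm_mul_mul(_sub_mem)`** —
  `q(AG,BH) = AB·q(G,H) + B·Σ_v(HQ_v − GR_v)∂_vA ≡ AB·q(G,H)` (the `K[x]`-bilinearity used in Example 5.1,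
  "by Remark 2.3 this is reduced to check that `q(x_0 − ζx_1, x_0 − ζx_1) = 0`"); all given `H_1 = 0`, which holds
  (**`hasKoszulSyzygies_pderiv_of_X_pow_mem`**, **`…_of_isArtinianGorenstein`**) for every form `F` of degree
  `d ≥ 2` whose Jacobian ideal contains a power of each variable / is Artinian Gorenstein (the tree's "finite
  Jacobian ring ⇒ the partials form a regular sequence", `isRegular_of_X_pow_mem`, transported along a numbering
  of the variables, + Matsumura 16.5 (i)).

**§2 — Theorem 1.3, eq. (eqQFFjoin), in general** (`f ∈ K[σ]`, `g ∈ K[τ]`, `F = joinPoly f g = f(x) + g(y)`,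
`P = P_{Z_1}(x)P_{Z_2}(y)`; the tree's earlier `JoinFakeQuadraticForm.lean` had only the case `G_1 = H_1 = y_0 − cy_1`,
`A_2 = B_2 = 0`):
* the induced lifts `liftInl`/`liftInr` of `A·G_1(x)`, `A·G_2(y)` against `P` and their legitimacy
  (`mul_eq_sum_liftInl/Inr`, `join_mul_eq_sum_lift`);
* the FOUR elementary cases as EXACT polynomial identities — `macleanForm_inl_inl` (`= AB P_{Z_2} q_1(G_1,H_1)
  + B P_{Z_2} Σ_i (H_1Q_i − G_1S_i)∂A/∂x_i`, the printed display), `macleanForm_inr_inr`, and the mixed cases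
  `macleanForm_inl_inr` / `macleanForm_inr_inl` (`= B·(H_2P_{Z_2})·Σ_i∂(AQ_i)/∂x_i − B·(G_1P_{Z_1})·Σ_jT_j∂A/∂y_j`, two
  groups of terms in `J^{f+g}` which the printed display omits — immaterial for the theorem);
* **`macleanForm_join_sub_mem_of_koszul`** — (eqQFFjoin) exactly as printed, modulo `J^{f+g}`, under the printed
  Koszul memberships `H_1Q_i − G_1S_i ∈ J^f`, `H_2R_j − G_2T_j ∈ J^g`; `sub_mem_span_pderiv_of_lifts` — these hold
  when `H_1(∂f) = 0`; **`macleanForm_join_sub_mem`** — (eqQFFjoin) modulo `J^{f+g}` for all forms `f`, `g` of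
  degrees `≥ 2` with Artinian Gorenstein Jacobian ideals (the tree's rendering of "`X_1`, `X_2` smooth"), all
  `G_i, H_i`, all lifts, all `A_i, B_i`; and `hasKoszulSyzygies_pderiv_joinPoly` — the partials of `f + g` again have
  `H_1 = 0` (so by §1 the left side is lift-independent modulo `J^{f+g} ⊆ J^{f+g} + ⟨P_{Z_1}P_{Z_2}⟩`).

**§3 — Theorem 1.3 (i), generator form** (`macleanForm_join_mem_of_generators`; n-ary bookkeeping
`macleanForm_sum_left/right`, `sum_mul_eq_sum_sum_lift`, `exists_sum_eq_of_mem_map_span_sup`): for forms `f`, `g` of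
degree `d ≥ 2` with Artinian Gorenstein Jacobian ideals and generating sets `𝒢_1` of `(J^f : P_{Z_1})`, `𝒢_2` of
`(J^g : P_{Z_2})`: if `q_1(a,b) ∈ J^f + ⟨P_{Z_1}⟩` for all `a, b ∈ 𝒢_1` (all lifts) and `q_2(a,b) ∈ J^g + ⟨P_{Z_2}⟩`
for all `a, b ∈ 𝒢_2`, then `q(G,H) ∈ J^{f+g} + ⟨P_{Z_1}P_{Z_2}⟩` for ALL `G, H ∈ (J^{f+g} : P_{Z_1}P_{Z_2})` and all
lifts — "(i) by a direct computation in the generators of `J^{f+g,[J(Z_1,Z_2)]}` which are generators of either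
`J^{f,[Z_1]}` or `J^{g,[Z_2]}`" (Thm. 1.1, tree `IsArtinianGorenstein.colon_join`), the form in which (i) is used
in Example 5.1 and Propositions 5.1–5.3. We read "`q_1` vanishes in all degrees `ℓ ≤ e`" as vanishing on all
pairs of elements (of possibly different degrees). The computation itself is `macleanForm_join_mem_of_mem_span`
(arbitrary subsets `𝒢_i` of the colon ideals, `G, H ∈ ⟨𝒢_1(x)⟩ + ⟨𝒢_2(y)⟩`), and the **degree-`e` statement** is
`macleanForm_join_mem_of_generators_of_degree_le`: for HOMOGENEOUS generating sets `𝒢_i`, if `q_i` vanishes on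
all pairs of generators of degrees `≤ e`, then `q(G,H) ∈ J^{f+g} + ⟨P_{Z_1}P_{Z_2}⟩` for all forms `G, H` of
degree `e` in `(J^{f+g} : P_{Z_1}P_{Z_2})` (forms of degree `e` in an ideal with homogeneous generators are
generated by the generators of degree `≤ e`, `mem_span_sep_of_isHomogeneous`).

NOT formalised here: Maclean's theorem itself [Maclean 2005] (cited through Thm. 2.1); Thm. 1.3 (ii)
(`JoinQuadraticFormPartialConverse.lean`) and the applications of §5 (Example 5.1:
`FermatLinearCycleQuadraticFormVanishes.lean`); the residue description of `P_λ`.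

HONEST FRAMING (cell pub-hlocus): certified instances and evidence bearing on the general Hodge conjecture;
no claim.

## References

* [DuqueFrancoVillaflor2025Join] J. Duque Franco, R. Villaflor Loyola, *Periods of join algebraic cycles*,
  Ann. Sc. Norm. Super. Pisa Cl. Sci. (2025) = arXiv:2312.17222, Theorem 1.3 and its proof (p. 11), Theorem 2.1,
  Remark 2.3, Example 5.1 (= arXiv v4: Theorem 4.1, Theorem 2.1, Remark 2.3, Example 5.1).
* [Matsumura1987] H. Matsumura, *Commutative Ring Theory*, CUP 1986, §16, Theorem 16.5 (i).
* [DuquefrancoVillaflorloyola2023] J. Duque Franco, R. Villaflor Loyola, *On fake linear cycles inside Fermat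
  varieties*, Algebra & Number Theory 17 (2023), Thm. 6.1 (Maclean's formula; tree `macleanForm`).
-/

noncomputable section

namespace Literature.AlgebraicGeometry.DuqueFrancoVillaflor2025

open MvPolynomial Finset RingTheory.Sequence
open Literature.RingTheory.Koszul Literature.RingTheory.MvPolynomial
open Literature.AlgebraicGeometry.HodgeTheory
open Literature.AlgebraicGeometry.DuqueFrancoVillaflor2023 (macleanForm)

universe u v w

variable {K : Type u} [Field K]

/-! ## §1. Maclean's form `q(G,H) = Σ_v (H ∂_v Q_v − R_v ∂_v G)`: bilinearity and change of lifts -/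

section Calculus

variable {σ : Type v} [Fintype σ]

omit [Fintype σ] in
/-- Partial derivatives commute (Schwarz on monomials). [folklore] -/
private theorem pderiv_pderiv_comm' (i j : σ) (p : MvPolynomial σ K) :
    pderiv i (pderiv j p) = pderiv j (pderiv i p) := by
  classical
  rcases eq_or_ne i j with rfl | hij
  · rfl
  ext m
  simp only [coeff_pderiv, Finsupp.add_apply, Finsupp.single_apply, if_neg hij,
    if_neg hij.symm, add_zero]
  rw [add_right_comm m (Finsupp.single i 1) (Finsupp.single j 1)]
  ring

/-- `q` is additive in the pair `(G, Q)` ("bilinear form", Thm. 2.1).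
[cite: DuqueFrancoVillaflor2025Join, Theorem 2.1 (Maclean)] -/
theorem macleanForm_add_left (G G' H : MvPolynomial σ K) (Q Q' R : σ → MvPolynomial σ K) :
    macleanForm (G + G') H (Q + Q') R = macleanForm G H Q R + macleanForm G' H Q' R := by
  simp only [macleanForm, Pi.add_apply, map_add, ← Finset.sum_add_distrib]
  exact Finset.sum_congr rfl fun v _ => by ring

/-- `q` is additive in the pair `(H, R)` ("bilinear form", Thm. 2.1).
[cite: DuqueFrancoVillaflor2025Join, Theorem 2.1 (Maclean)] -/
theorem macleanForm_add_right (G H H' : MvPolynomial σ K) (Q R R' : σ → MvPolynomial σ K) :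
    macleanForm G (H + H') Q (R + R') = macleanForm G H Q R + macleanForm G H' Q R' := by
  simp only [macleanForm, Pi.add_apply, ← Finset.sum_add_distrib]
  exact Finset.sum_congr rfl fun v _ => by ring

/-- `q(Σ_k G_k, H; Σ_k Q_k, R) = Σ_k q(G_k, H; Q_k, R)`. [cite: DuqueFrancoVillaflor2025Join, Theorem 2.1 (Maclean) ("bilinear form")] -/
theorem macleanForm_sum_left {ι : Type*} (s : Finset ι) (G : ι → MvPolynomial σ K) (H : MvPolynomial σ K)
    (Q : ι → σ → MvPolynomial σ K) (R : σ → MvPolynomial σ K) :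
    macleanForm (∑ k ∈ s, G k) H (∑ k ∈ s, Q k) R = ∑ k ∈ s, macleanForm (G k) H (Q k) R := by
  classical
  induction s using Finset.induction_on with
  | empty => simp [macleanForm]
  | insert a s ha ih =>
    rw [Finset.sum_insert ha, Finset.sum_insert ha, Finset.sum_insert ha, macleanForm_add_left, ih]

/-- `q(G, Σ_l H_l; Q, Σ_l R_l) = Σ_l q(G, H_l; Q, R_l)`. [cite: DuqueFrancoVillaflor2025Join, Theorem 2.1 (Maclean) ("bilinear form")] -/
theorem macleanForm_sum_right {ι : Type*} (s : Finset ι) (G : MvPolynomial σ K) (H : ι → MvPolynomial σ K)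
    (Q : σ → MvPolynomial σ K) (R : ι → σ → MvPolynomial σ K) :
    macleanForm G (∑ l ∈ s, H l) Q (∑ l ∈ s, R l) = ∑ l ∈ s, macleanForm G (H l) Q (R l) := by
  classical
  induction s using Finset.induction_on with
  | empty => simp [macleanForm]
  | insert a s ha ih =>
    rw [Finset.sum_insert ha, Finset.sum_insert ha, Finset.sum_insert ha, macleanForm_add_right, ih]

/-- Lifts add up: if `G_k·P = Σ_z 𝒬_{k,z} ∂_zF` for every `k`, then `(Σ_k G_k)·P = Σ_z (Σ_k 𝒬_{k,z}) ∂_zF`.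
[cite: DuqueFrancoVillaflor2025Join, Theorem 2.1 (Maclean)] -/
theorem sum_mul_eq_sum_sum_lift {ι : Type*} (s : Finset ι) {G : ι → MvPolynomial σ K}
    {𝒬 : ι → σ → MvPolynomial σ K} {P F : MvPolynomial σ K}
    (h : ∀ k ∈ s, G k * P = ∑ v, 𝒬 k v * pderiv v F) :
    (∑ k ∈ s, G k) * P = ∑ v, (∑ k ∈ s, 𝒬 k) v * pderiv v F := by
  rw [Finset.sum_mul, Finset.sum_congr rfl h, Finset.sum_comm]
  refine Finset.sum_congr rfl fun v _ => ?_
  rw [Finset.sum_apply, Finset.sum_mul]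

/-- Changing the lift of `G`: `q(G,H; Q, R) − q(G,H; Q', R) = H · Σ_v ∂_v(Q_v − Q'_v)`.
[cite: DuqueFrancoVillaflor2025Join, Theorem 2.1 (Maclean), eq. (eqQFF)] -/
theorem macleanForm_sub_macleanForm_left (G H : MvPolynomial σ K) (Q Q' R : σ → MvPolynomial σ K) :
    macleanForm G H Q R - macleanForm G H Q' R = H * ∑ v, pderiv v (Q v - Q' v) := by
  simp only [macleanForm, map_sub, Finset.mul_sum, ← Finset.sum_sub_distrib]
  exact Finset.sum_congr rfl fun v _ => by ring

/-- Changing the lift of `H`: `q(G,H; Q, R) − q(G,H; Q, R') = −Σ_v (R_v − R'_v) ∂_v G`.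
[cite: DuqueFrancoVillaflor2025Join, Theorem 2.1 (Maclean), eq. (eqQFF)] -/
theorem macleanForm_sub_macleanForm_right (G H : MvPolynomial σ K) (Q R R' : σ → MvPolynomial σ K) :
    macleanForm G H Q R - macleanForm G H Q R' = -∑ v, (R v - R' v) * pderiv v G := by
  simp only [macleanForm, ← Finset.sum_sub_distrib, ← Finset.sum_neg_distrib]
  exact Finset.sum_congr rfl fun v _ => by ring

/-- Swapping the arguments: `q(G,H; Q,R) − q(H,G; R,Q) = Σ_v ∂_v (H Q_v − G R_v)` — the divergence of the
syzygy `H·Q − G·R`. [cite: DuqueFrancoVillaflor2025Join, Theorem 2.1 (Maclean) ("`Sym²`")] -/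
theorem macleanForm_sub_macleanForm_swap (G H : MvPolynomial σ K) (Q R : σ → MvPolynomial σ K) :
    macleanForm G H Q R - macleanForm H G R Q = ∑ v, pderiv v (H * Q v - G * R v) := by
  simp only [macleanForm, ← Finset.sum_sub_distrib, map_sub, pderiv_mul]
  exact Finset.sum_congr rfl fun v _ => by ring

/-! ### The divergence of a trivial syzygy lies in the Jacobian ideal (symmetry of the Hessian) -/

/-- **The divergence of a Koszul boundary lies in `J^F`**: for any `a`,
`Σ_v ∂_v (Σ_w (a_{vw} − a_{wv}) ∂_w F) = Σ_{v,w} ∂_v(a_{vw} − a_{wv})·∂_w F + Σ_{v,w} (a_{vw} − a_{wv}) ∂_v∂_w F`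
and the second sum vanishes because `∂_v∂_w F = ∂_w∂_v F`.
[cite: DuqueFrancoVillaflor2025Join, Theorem 2.1 (Maclean) (well-definedness of `q` on `R^F/⟨P_λ⟩`)] -/
theorem sum_pderiv_koszulBoundary_mem (F : MvPolynomial σ K) (a : σ → σ → MvPolynomial σ K) :
    ∑ v, pderiv v (∑ w, (a v w - a w v) * pderiv w F) ∈ Ideal.span (Set.range fun v => pderiv v F) := by
  have h : ∑ v, pderiv v (∑ w, (a v w - a w v) * pderiv w F) =
      ∑ v, ∑ w, pderiv v (a v w - a w v) * pderiv w F +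
        ∑ v, ∑ w, (a v w - a w v) * pderiv v (pderiv w F) := by
    rw [← Finset.sum_add_distrib]
    refine Finset.sum_congr rfl fun v _ => ?_
    rw [map_sum, ← Finset.sum_add_distrib]
    refine Finset.sum_congr rfl fun w _ => ?_
    rw [pderiv_mul]
  have h0 : ∑ v, ∑ w, (a v w - a w v) * pderiv v (pderiv w F) = (0 : MvPolynomial σ K) := by
    simp_rw [sub_mul, Finset.sum_sub_distrib]
    rw [sub_eq_zero, Finset.sum_comm]
    refine Finset.sum_congr rfl fun w _ => Finset.sum_congr rfl fun v _ => ?_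
    rw [pderiv_pderiv_comm' v w]
  rw [h, h0, add_zero]
  exact Ideal.sum_mem _ fun v _ => Ideal.sum_mem _ fun w _ =>
    Ideal.mul_mem_left _ _ (Ideal.subset_span ⟨w, rfl⟩)

/-- **If the partials of `F` have only trivial syzygies, the divergence `Σ_v ∂_v δ_v` of every syzygy
`Σ_v δ_v ∂_v F = 0` lies in `J^F`.**
[cite: DuqueFrancoVillaflor2025Join, Theorem 2.1 (Maclean) (well-definedness of `q` on `R^F/⟨P_λ⟩`)]
[cite: Matsumura1987, §16, Theorem 16.5 (i)] -/
theorem sum_pderiv_mem_of_syzygy {F : MvPolynomial σ K} (hK : HasKoszulSyzygies fun v => pderiv v F)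
    {δ : σ → MvPolynomial σ K} (hδ : ∑ v, δ v * pderiv v F = 0) :
    ∑ v, pderiv v (δ v) ∈ Ideal.span (Set.range fun v => pderiv v F) := by
  obtain ⟨a, ha⟩ := hK δ hδ
  simp_rw [ha]
  exact sum_pderiv_koszulBoundary_mem F a

/-- … and trivially `Σ_v δ_v ∂_v G ∈ J^F` (each `δ_v ∈ J^F`).
[cite: Matsumura1987, §16, Theorem 16.5 (i)] -/
theorem sum_mul_pderiv_mem_of_syzygy {F : MvPolynomial σ K} (hK : HasKoszulSyzygies fun v => pderiv v F)
    {δ : σ → MvPolynomial σ K} (hδ : ∑ v, δ v * pderiv v F = 0) (G : MvPolynomial σ K) :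
    ∑ v, δ v * pderiv v G ∈ Ideal.span (Set.range fun v => pderiv v F) :=
  Ideal.sum_mem _ fun v _ => Ideal.mul_mem_right _ _ (hK.mem_span_range hδ v)

/-- **The Koszul step**: if the partials of `f` have only trivial syzygies, two lifts of `G_1P_{Z_1}` and
`H_1P_{Z_1}` satisfy `H_1Q_i − G_1S_i ∈ J^f` for every `i` — "Note that `Σ_i (H_1Q_i − G_1S_i) ∂f/∂x_i = 0`.
Since (`∂f/∂x_0, …`) … are regular sequences, it follows by the exactness of the Koszul complex that
`H_1Q_i − G_1S_i ∈ J^f`". [cite: DuqueFrancoVillaflor2025Join, Theorem 1.3 (proof; = Theorem 4.1 of arXiv v4)]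
[cite: Matsumura1987, §16, Theorem 16.5 (i)] -/
theorem sub_mem_span_pderiv_of_lifts {f G₁ H₁ P₁ : MvPolynomial σ K} {Q S : σ → MvPolynomial σ K}
    (hK : HasKoszulSyzygies fun i => pderiv i f)
    (hQ : G₁ * P₁ = ∑ i, Q i * pderiv i f) (hS : H₁ * P₁ = ∑ i, S i * pderiv i f) (i : σ) :
    H₁ * Q i - G₁ * S i ∈ Ideal.span (Set.range fun i => pderiv i f) := by
  refine hK.mem_span_range (c := fun i => H₁ * Q i - G₁ * S i) ?_ i
  calc ∑ i, (H₁ * Q i - G₁ * S i) * pderiv i f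
      = H₁ * ∑ i, Q i * pderiv i f - G₁ * ∑ i, S i * pderiv i f := by
        rw [Finset.mul_sum, Finset.mul_sum, ← Finset.sum_sub_distrib]
        exact Finset.sum_congr rfl fun i _ => by ring
    _ = 0 := by rw [← hQ, ← hS]; ring

/-- **`q` is `S`-bilinear up to the Koszul term** (the one-ring case of the computation proving (eqQFFjoin)):
for the induced lifts `A·Q` of `(AG)·P` and `B·R` of `(BH)·P`,
`q(AG, BH; AQ, BR) = A·B·q(G,H; Q,R) + B·Σ_v (H Q_v − G R_v) ∂_v A` EXACTLY.
[cite: DuqueFrancoVillaflor2025Join, Theorem 1.3 (proof, the term `B_1P_{Z_2}Σ_i(H_1Q_i − G_1S_i)∂A_1/∂x_i`; = Theorem 4.1 of arXiv v4)] -/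
theorem macleanForm_mul_mul (A B G H : MvPolynomial σ K) (Q R : σ → MvPolynomial σ K) :
    macleanForm (A * G) (B * H) (fun v => A * Q v) (fun v => B * R v) =
      A * B * macleanForm G H Q R + B * ∑ v, (H * Q v - G * R v) * pderiv v A := by
  simp only [macleanForm, pderiv_mul, Finset.mul_sum, ← Finset.sum_add_distrib]
  exact Finset.sum_congr rfl fun v _ => by ring

/-- The induced lift is legitimate: `(AG)·P = Σ_v (A Q_v) ∂_vF`. [cite: DuqueFrancoVillaflor2025Join, Theorem 1.3 (proof)] -/
theorem mul_mul_eq_sum_mul_lift {F G P : MvPolynomial σ K} {Q : σ → MvPolynomial σ K}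
    (hQ : G * P = ∑ v, Q v * pderiv v F) (A : MvPolynomial σ K) :
    A * G * P = ∑ v, (A * Q v) * pderiv v F := by
  rw [mul_assoc, hQ, Finset.mul_sum]
  exact Finset.sum_congr rfl fun v _ => by ring

/-- **Hence `q(AG, BH) ≡ A·B·q(G, H)` modulo `J^F`** whenever the partials of `F` have only trivial syzygies —
the `K[x]`-bilinearity used to reduce the vanishing of `q` to generators ("by (rmkqffjac) this is reduced
to check that `q(x_0 − ζ_{2d}x_1, x_0 − ζ_{2d}x_1) = 0`", Example 5.1).
[cite: DuqueFrancoVillaflor2025Join, Theorem 1.3 (proof) and Example 5.1] -/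
theorem macleanForm_mul_mul_sub_mem {F G H P : MvPolynomial σ K} (hK : HasKoszulSyzygies fun v => pderiv v F)
    {Q R : σ → MvPolynomial σ K} (hQ : G * P = ∑ v, Q v * pderiv v F) (hR : H * P = ∑ v, R v * pderiv v F)
    (A B : MvPolynomial σ K) :
    macleanForm (A * G) (B * H) (fun v => A * Q v) (fun v => B * R v) - A * B * macleanForm G H Q R ∈
      Ideal.span (Set.range fun v => pderiv v F) := by
  rw [macleanForm_mul_mul, add_sub_cancel_left]
  exact Ideal.mul_mem_left _ _ (Ideal.sum_mem _ fun v _ =>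
    Ideal.mul_mem_right _ _ (sub_mem_span_pderiv_of_lifts hK hQ hR v))

/-! ### Theorem 2.1 (Maclean): `q` does not depend on the lifts, is symmetric, and kills `J^F` — modulo `J^F` -/

/-- **`q(G,H)` is independent of the chosen lifts modulo `J^F`**: if `Σ Q_v ∂_vF = Σ Q'_v ∂_vF` (two lifts of
`G·P_λ`) and `Σ R_v ∂_vF = Σ R'_v ∂_vF` (two lifts of `H·P_λ`), then `q(G,H;Q,R) − q(G,H;Q',R') ∈ J^F` — the
algebraic content of "`q : Sym²(J^{F,λ}) → R^F/⟨P_λ⟩` is the bilinear form given by (eqQFF) where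
`G·P_λ = Σ Q_i ∂F/∂x_i` and `H·P_λ = Σ R_i ∂F/∂x_i`", valid whenever the partials of `F` have only trivial
syzygies (e.g. `X = {F = 0}` smooth, below). [cite: DuqueFrancoVillaflor2025Join, Theorem 2.1 (Maclean)] -/
theorem macleanForm_sub_macleanForm_mem_of_lifts {F G H : MvPolynomial σ K}
    (hK : HasKoszulSyzygies fun v => pderiv v F) {Q Q' R R' : σ → MvPolynomial σ K}
    (hQ : ∑ v, Q v * pderiv v F = ∑ v, Q' v * pderiv v F)
    (hR : ∑ v, R v * pderiv v F = ∑ v, R' v * pderiv v F) :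
    macleanForm G H Q R - macleanForm G H Q' R' ∈ Ideal.span (Set.range fun v => pderiv v F) := by
  have e : macleanForm G H Q R - macleanForm G H Q' R' =
      (macleanForm G H Q R - macleanForm G H Q' R) + (macleanForm G H Q' R - macleanForm G H Q' R') := by
    ring
  rw [e, macleanForm_sub_macleanForm_left, macleanForm_sub_macleanForm_right]
  refine Ideal.add_mem _ (Ideal.mul_mem_left _ _ ?_) (Submodule.neg_mem _ ?_)
  · refine sum_pderiv_mem_of_syzygy hK (δ := fun v => Q v - Q' v) ?_
    simp only [sub_mul, Finset.sum_sub_distrib, hQ, sub_self]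
  · refine sum_mul_pderiv_mem_of_syzygy hK (δ := fun v => R v - R' v) ?_ G
    simp only [sub_mul, Finset.sum_sub_distrib, hR, sub_self]

/-- The same with the lifts written as lifts of `G·P` and `H·P`.
[cite: DuqueFrancoVillaflor2025Join, Theorem 2.1 (Maclean)] -/
theorem macleanForm_sub_macleanForm_mem_of_lifts' {F G H P : MvPolynomial σ K}
    (hK : HasKoszulSyzygies fun v => pderiv v F) {Q Q' R R' : σ → MvPolynomial σ K}
    (hQ : G * P = ∑ v, Q v * pderiv v F) (hQ' : G * P = ∑ v, Q' v * pderiv v F)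
    (hR : H * P = ∑ v, R v * pderiv v F) (hR' : H * P = ∑ v, R' v * pderiv v F) :
    macleanForm G H Q R - macleanForm G H Q' R' ∈ Ideal.span (Set.range fun v => pderiv v F) :=
  macleanForm_sub_macleanForm_mem_of_lifts hK (hQ.symm.trans hQ') (hR.symm.trans hR')

/-- **`q` is symmetric modulo `J^F`** ("`Sym²`"): for legitimate lifts, `q(G,H;Q,R) − q(H,G;R,Q) ∈ J^F`, since
`H·Q − G·R` is a syzygy of the partials (`Σ (HQ_v − GR_v)∂_vF = H·GP − G·HP = 0`).
[cite: DuqueFrancoVillaflor2025Join, Theorem 2.1 (Maclean)] -/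
theorem macleanForm_sub_macleanForm_swap_mem {F G H P : MvPolynomial σ K}
    (hK : HasKoszulSyzygies fun v => pderiv v F) {Q R : σ → MvPolynomial σ K}
    (hQ : G * P = ∑ v, Q v * pderiv v F) (hR : H * P = ∑ v, R v * pderiv v F) :
    macleanForm G H Q R - macleanForm H G R Q ∈ Ideal.span (Set.range fun v => pderiv v F) := by
  rw [macleanForm_sub_macleanForm_swap]
  refine sum_pderiv_mem_of_syzygy hK ?_
  calc ∑ v, (H * Q v - G * R v) * pderiv v F
      = H * ∑ v, Q v * pderiv v F - G * ∑ v, R v * pderiv v F := by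
        rw [Finset.mul_sum, Finset.mul_sum, ← Finset.sum_sub_distrib]
        exact Finset.sum_congr rfl fun v _ => by ring
    _ = 0 := by rw [← hQ, ← hR]; ring

/-- **Remark 2.3: `q(·, H) = 0` for `H ∈ J^F`** — modulo `J^F + ⟨P_λ⟩`, for ANY legitimate lifts: writing
`H = Σ c_v ∂_vF`, the lift `R_v = c_v P_λ` gives `q(G,H) = H·Σ∂_vQ_v − P_λ·Σ c_v ∂_vG`, and any other lift of
`H·P_λ` changes `q` by an element of `J^F`. [cite: DuqueFrancoVillaflor2025Join, Remark 2.3] -/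
theorem macleanForm_mem_of_mem_span_pderiv {F G H P : MvPolynomial σ K}
    (hK : HasKoszulSyzygies fun v => pderiv v F) (hH : H ∈ Ideal.span (Set.range fun v => pderiv v F))
    {Q R : σ → MvPolynomial σ K} (hR : H * P = ∑ v, R v * pderiv v F) :
    macleanForm G H Q R ∈ Ideal.span (Set.range fun v => pderiv v F) ⊔ Ideal.span {P} := by
  obtain ⟨c, hc⟩ := Ideal.mem_span_range_iff_exists_fun.mp hH
  have hR0 : H * P = ∑ v, (c v * P) * pderiv v F := by
    rw [← hc, Finset.sum_mul]
    exact Finset.sum_congr rfl fun v _ => by ring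
  have h1 : macleanForm G H Q R - macleanForm G H Q (fun v => c v * P) ∈
      Ideal.span (Set.range fun v => pderiv v F) :=
    macleanForm_sub_macleanForm_mem_of_lifts hK rfl (hR.symm.trans hR0)
  have h2 : macleanForm G H Q (fun v => c v * P) =
      H * ∑ v, pderiv v (Q v) - P * ∑ v, c v * pderiv v G := by
    simp only [macleanForm, Finset.mul_sum, ← Finset.sum_sub_distrib]
    exact Finset.sum_congr rfl fun v _ => by ring
  have h3 : macleanForm G H Q (fun v => c v * P) ∈
      Ideal.span (Set.range fun v => pderiv v F) ⊔ Ideal.span {P} := by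
    rw [h2]
    exact Ideal.sub_mem _ (Ideal.mem_sup_left (Ideal.mul_mem_right _ _ hH))
      (Ideal.mem_sup_right (Ideal.mul_mem_right _ _ (Ideal.mem_span_singleton_self P)))
  have e : macleanForm G H Q R =
      (macleanForm G H Q R - macleanForm G H Q (fun v => c v * P)) + macleanForm G H Q (fun v => c v * P) := by
    ring
  rw [e]
  exact Ideal.add_mem _ (Ideal.mem_sup_left h1) h3

/-! ### The partials of a form with Artinian Jacobian ring have only trivial syzygies -/

/-- **The partials `∂F/∂x_v` of a form `F` of degree `d ≥ 2` whose Jacobian ideal contains a power of every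
variable (equivalently: `S/J^F` is finite-dimensional, e.g. `{F = 0}` smooth) have only trivial syzygies**
(`H_1` of their Koszul complex vanishes): "`(∂f/∂x_0, …, ∂f/∂x_{k+1})` … are regular sequences, it follows by
the exactness of the Koszul complex that …" — the tree's `isRegular_of_X_pow_mem` (finite quotient ⇒ regular
sequence) transported along a numbering `σ ≃ Fin m` of the variables, and Matsumura's Thm. 16.5 (i).
[cite: DuqueFrancoVillaflor2025Join, Theorem 1.3 (proof; = Theorem 4.1 of arXiv v4)]
[cite: Matsumura1987, §16, Theorem 16.5 (i)] -/
theorem hasKoszulSyzygies_pderiv_of_X_pow_mem {F : MvPolynomial σ K} {d : ℕ} (hF : F.IsHomogeneous d)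
    (hd : 2 ≤ d) {N : ℕ}
    (hX : ∀ v : σ, (X v : MvPolynomial σ K) ^ N ∈ Ideal.span (Set.range fun w => pderiv w F)) :
    HasKoszulSyzygies fun v => pderiv v F := by
  classical
  set m := Fintype.card σ
  set e : σ ≃ Fin m := Fintype.equivFin σ with he
  set φ : MvPolynomial σ K ≃ₐ[K] MvPolynomial (Fin m) K := renameEquiv K e with hφ
  set g : σ → MvPolynomial σ K := fun v => pderiv v F with hg
  set g' : Fin m → MvPolynomial (Fin m) K := fun k => φ (g (e.symm k)) with hg'
  have hg'eq : ∀ k, g' k = pderiv k (rename e F) := by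
    intro k
    simp only [hg', hg, hφ, renameEquiv_apply]
    conv_rhs => rw [← e.apply_symm_apply k]
    rw [pderiv_rename e.injective]
  have hhom : ∀ k, (g' k).IsHomogeneous (d - 1) := fun k => by
    rw [hg'eq]
    exact (hF.rename_isHomogeneous).pderiv
  -- `(range g') = φ(range g)`, so `span (range g') = φ(J^F)`
  have hmap : (Ideal.span (Set.range g)).map φ = Ideal.span (Set.range g') := by
    rw [Ideal.map_span, ← Set.range_comp]
    congr 1
    have : g' = (⇑φ ∘ g) ∘ e.symm := rfl
    rw [this, e.symm.surjective.range_comp]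
  have hXN : ∀ k : Fin m, (X k : MvPolynomial (Fin m) K) ^ N ∈ Ideal.span (Set.range g') := by
    intro k
    have h1 : (X k : MvPolynomial (Fin m) K) ^ N = φ (X (e.symm k) ^ N) := by
      rw [map_pow, hφ, renameEquiv_apply, rename_X, Equiv.apply_symm_apply]
    rw [h1, ← hmap]
    exact Ideal.mem_map_of_mem _ (hX (e.symm k))
  have hreg := isRegular_of_X_pow_mem g' (fun _ => d - 1) hhom (fun _ => by omega) hXN
  have hK' : HasKoszulSyzygies g' := hasKoszulSyzygies_of_isWeaklyRegular g' hreg.toIsWeaklyRegular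
  have hK'' : HasKoszulSyzygies fun k => φ.symm (g' k) := hK'.map_ringEquiv φ.symm.toRingEquiv
  have hcomp : (fun k => φ.symm (g' k)) = g ∘ e.symm := by
    funext k
    simp [hg']
  rw [hcomp] at hK''
  exact HasKoszulSyzygies.of_comp_equiv e.symm hK''

/-- The same under the tree's Artinian Gorenstein hypothesis on `J^F` (`J^F_e = S_e` for `e > soc`, so
`x_v^{soc+1} ∈ J^F`). [cite: DuqueFrancoVillaflor2025Join, Definition 2.1 (i), Theorem 2.1 (Maclean)]
[cite: Matsumura1987, §16, Theorem 16.5 (i)] -/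
theorem hasKoszulSyzygies_pderiv_of_isArtinianGorenstein {F : MvPolynomial σ K} {d s : ℕ}
    (hF : F.IsHomogeneous d) (hd : 2 ≤ d)
    (hJ : IsArtinianGorenstein (Ideal.span (Set.range fun w => pderiv w F)) s) :
    HasKoszulSyzygies fun v => pderiv v F := by
  refine hasKoszulSyzygies_pderiv_of_X_pow_mem hF hd (N := s + 1) fun v => ?_
  have hmem : (X v : MvPolynomial σ K) ^ (s + 1) ∈ idealDegree (Ideal.span (Set.range fun w => pderiv w F)) (s + 1) := by
    rw [hJ.idealDegree_eq_of_lt (Nat.lt_succ_self s), mem_homogeneousSubmodule]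
    exact isHomogeneous_X_pow v (s + 1)
  exact (mem_idealDegree.mp hmem).1

end Calculus

/-! ## §2. The join `F = f(x) + g(y)` and Maclean's lifts of `A_1G_1 + A_2G_2` -/

section Join

variable {σ : Type v} {τ : Type w} [Fintype σ] [Fintype τ]

/-- **`F = f + g ∈ K[x, y]`** for `f ∈ K[x]` (`Sum.inl` variables) and `g ∈ K[y]` (`Sum.inr` variables): the
equation of the hypersurface carrying the join cycles `J(Z_1, Z_2)`; `X = {f + g = 0}`.
[cite: DuqueFrancoVillaflor2025Join, Theorem 1.1 and Theorem 1.3 (= Theorems 1.2 and 4.1 of arXiv v4)] -/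
def joinPoly (f : MvPolynomial σ K) (g : MvPolynomial τ K) : MvPolynomial (σ ⊕ τ) K :=
  rename Sum.inl f + rename Sum.inr g

variable (f : MvPolynomial σ K) (g : MvPolynomial τ K)

omit [Fintype σ] [Fintype τ] in
/-- A polynomial in `y` has no `x`-derivatives. [folklore] -/
private theorem pderiv_inl_rename_inr (i : σ) (q : MvPolynomial τ K) :
    pderiv (Sum.inl i) (rename Sum.inr q : MvPolynomial (σ ⊕ τ) K) = 0 := by
  classical
  refine pderiv_eq_zero_of_notMem_vars fun hmem => ?_
  obtain ⟨j, -, hj⟩ := Finset.mem_image.mp (vars_rename Sum.inr q hmem)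
  exact Sum.inr_ne_inl hj

omit [Fintype σ] [Fintype τ] in
/-- A polynomial in `x` has no `y`-derivatives. [folklore] -/
private theorem pderiv_inr_rename_inl (j : τ) (p : MvPolynomial σ K) :
    pderiv (Sum.inr j) (rename Sum.inl p : MvPolynomial (σ ⊕ τ) K) = 0 := by
  classical
  refine pderiv_eq_zero_of_notMem_vars fun hmem => ?_
  obtain ⟨i, -, hi⟩ := Finset.mem_image.mp (vars_rename Sum.inl p hmem)
  exact Sum.inl_ne_inr hi

omit [Fintype σ] [Fintype τ] in
/-- `∂/∂x_i` commutes with `p ↦ p(x)`. [folklore] -/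
private theorem pderiv_inl_rename_inl (i : σ) (p : MvPolynomial σ K) :
    pderiv (Sum.inl i) (rename Sum.inl p : MvPolynomial (σ ⊕ τ) K) = rename Sum.inl (pderiv i p) :=
  pderiv_rename Sum.inl_injective i p

omit [Fintype σ] [Fintype τ] in
/-- `∂/∂y_j` commutes with `q ↦ q(y)`. [folklore] -/
private theorem pderiv_inr_rename_inr (j : τ) (q : MvPolynomial τ K) :
    pderiv (Sum.inr j) (rename Sum.inr q : MvPolynomial (σ ⊕ τ) K) = rename Sum.inr (pderiv j q) :=
  pderiv_rename Sum.inr_injective j q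

omit [Fintype σ] [Fintype τ] in
/-- `∂(f+g)/∂x_i = (∂f/∂x_i)(x)`. [cite: DuqueFrancoVillaflor2025Join, Theorem 1.1 (proof)] -/
theorem pderiv_inl_joinPoly (i : σ) : pderiv (Sum.inl i) (joinPoly f g) = rename Sum.inl (pderiv i f) := by
  rw [joinPoly, map_add, pderiv_inl_rename_inl, pderiv_inl_rename_inr, add_zero]

omit [Fintype σ] [Fintype τ] in
/-- `∂(f+g)/∂y_j = (∂g/∂y_j)(y)`. [cite: DuqueFrancoVillaflor2025Join, Theorem 1.1 (proof)] -/
theorem pderiv_inr_joinPoly (j : τ) : pderiv (Sum.inr j) (joinPoly f g) = rename Sum.inr (pderiv j g) := by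
  rw [joinPoly, map_add, pderiv_inr_rename_inl, pderiv_inr_rename_inr, zero_add]

omit [Fintype σ] [Fintype τ] in
/-- `f + g` is a form of degree `d` when `f` and `g` are. [cite: DuqueFrancoVillaflor2025Join, Theorem 1.1] -/
theorem isHomogeneous_joinPoly {d : ℕ} (hf : f.IsHomogeneous d) (hg : g.IsHomogeneous d) :
    (joinPoly f g).IsHomogeneous d :=
  hf.rename_isHomogeneous.add hg.rename_isHomogeneous

omit [Fintype σ] [Fintype τ] in
/-- **`J^{f+g} = J^f·S + J^g·S`** (tree `span_pderiv_sebastianiThom`).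
[cite: DuqueFrancoVillaflor2025Join, Theorem 1.1 (proof: "`R^{f+g} = R^f ⊗ R^g`")] -/
theorem span_pderiv_joinPoly [Finite σ] [Finite τ] :
    Ideal.span (Set.range fun z => pderiv z (joinPoly f g)) =
      (Ideal.span (Set.range fun i => pderiv i f)).map (rename Sum.inl) ⊔
        (Ideal.span (Set.range fun j => pderiv j g)).map
          (rename Sum.inr : MvPolynomial τ K →ₐ[K] MvPolynomial (σ ⊕ τ) K) :=
  span_pderiv_sebastianiThom f g

/-- `p ∈ J^f ⟹ p(x) ∈ J^{f+g}`. [cite: DuqueFrancoVillaflor2025Join, Theorem 1.1 (proof)] -/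
theorem rename_inl_mem_span_pderiv_joinPoly {p : MvPolynomial σ K}
    (hp : p ∈ Ideal.span (Set.range fun i => pderiv i f)) :
    rename Sum.inl p ∈ Ideal.span (Set.range fun z => pderiv z (joinPoly f g)) := by
  rw [span_pderiv_joinPoly]
  exact Ideal.mem_sup_left (Ideal.mem_map_of_mem _ hp)

/-- `q ∈ J^g ⟹ q(y) ∈ J^{f+g}`. [cite: DuqueFrancoVillaflor2025Join, Theorem 1.1 (proof)] -/
theorem rename_inr_mem_span_pderiv_joinPoly {q : MvPolynomial τ K}
    (hq : q ∈ Ideal.span (Set.range fun j => pderiv j g)) :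
    rename Sum.inr q ∈ Ideal.span (Set.range fun z => pderiv z (joinPoly f g)) := by
  rw [span_pderiv_joinPoly]
  exact Ideal.mem_sup_right (Ideal.mem_map_of_mem _ hq)

/-- A lifted sum `Σ_i Q_i ∂f/∂x_i` read in `K[x,y]` lies in `J^{f+g}`. [cite: DuqueFrancoVillaflor2025Join, Theorem 1.3 (proof)] -/
theorem rename_inl_mem_of_eq_sum {p : MvPolynomial σ K} {Q : σ → MvPolynomial σ K}
    (hp : p = ∑ i, Q i * pderiv i f) :
    rename Sum.inl p ∈ Ideal.span (Set.range fun z => pderiv z (joinPoly f g)) := by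
  refine rename_inl_mem_span_pderiv_joinPoly f g ?_
  rw [hp]
  exact Ideal.sum_mem _ fun i _ => Ideal.mul_mem_left _ _ (Ideal.subset_span ⟨i, rfl⟩)

/-- A lifted sum `Σ_j R_j ∂g/∂y_j` read in `K[x,y]` lies in `J^{f+g}`. [cite: DuqueFrancoVillaflor2025Join, Theorem 1.3 (proof)] -/
theorem rename_inr_mem_of_eq_sum {q : MvPolynomial τ K} {R : τ → MvPolynomial τ K}
    (hq : q = ∑ j, R j * pderiv j g) :
    rename Sum.inr q ∈ Ideal.span (Set.range fun z => pderiv z (joinPoly f g)) := by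
  refine rename_inr_mem_span_pderiv_joinPoly f g ?_
  rw [hq]
  exact Ideal.sum_mem _ fun j _ => Ideal.mul_mem_left _ _ (Ideal.subset_span ⟨j, rfl⟩)

/-! ### The lifts of `A·G_1(x)` and `A·G_2(y)` against `P = P_{Z_1}(x) P_{Z_2}(y)` -/

/-- **The lift of `A·G_1(x)`**: if `G_1 P_{Z_1} = Σ_i Q_i ∂f/∂x_i` then
`(A G_1)·(P_{Z_1}P_{Z_2}) = Σ_i (A P_{Z_2} Q_i) ∂(f+g)/∂x_i`, i.e. `𝒬_{x_i} = A·P_{Z_2}·Q_i`, `𝒬_{y_j} = 0`.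
[cite: DuqueFrancoVillaflor2025Join, Theorem 1.3 (proof: "`G_1·P_{Z_1} = Σ Q_i ∂f/∂x_i`"; = Theorem 4.1 of arXiv v4)] -/
def liftInl (P₂ : MvPolynomial τ K) (A : MvPolynomial (σ ⊕ τ) K) (Q : σ → MvPolynomial σ K) :
    σ ⊕ τ → MvPolynomial (σ ⊕ τ) K :=
  Sum.elim (fun i => A * rename Sum.inr P₂ * rename Sum.inl (Q i)) fun _ => 0

/-- **The lift of `A·G_2(y)`**: if `G_2 P_{Z_2} = Σ_j R_j ∂g/∂y_j` then `𝒬_{y_j} = A·P_{Z_1}·R_j`, `𝒬_{x_i} = 0`.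
[cite: DuqueFrancoVillaflor2025Join, Theorem 1.3 (proof: "`G_2·P_{Z_2} = Σ R_j ∂g/∂y_j`"; = Theorem 4.1 of arXiv v4)] -/
def liftInr (P₁ : MvPolynomial σ K) (A : MvPolynomial (σ ⊕ τ) K) (R : τ → MvPolynomial τ K) :
    σ ⊕ τ → MvPolynomial (σ ⊕ τ) K :=
  Sum.elim (fun _ => 0) fun j => A * rename Sum.inl P₁ * rename Sum.inr (R j)

omit [Fintype σ] [Fintype τ] in
/-- `𝒬_{x_i} = A·P_{Z_2}·Q_i`. [cite: DuqueFrancoVillaflor2025Join, Theorem 1.3 (proof; = Theorem 4.1 of arXiv v4)] -/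
@[simp] theorem liftInl_inl (P₂ : MvPolynomial τ K) (A : MvPolynomial (σ ⊕ τ) K) (Q : σ → MvPolynomial σ K)
    (i : σ) : liftInl P₂ A Q (Sum.inl i) = A * rename Sum.inr P₂ * rename Sum.inl (Q i) := rfl

omit [Fintype σ] [Fintype τ] in
/-- `𝒬_{y_j} = 0` for the lift of `A·G_1(x)`. [cite: DuqueFrancoVillaflor2025Join, Theorem 1.3 (proof; = Theorem 4.1 of arXiv v4)] -/
@[simp] theorem liftInl_inr (P₂ : MvPolynomial τ K) (A : MvPolynomial (σ ⊕ τ) K) (Q : σ → MvPolynomial σ K)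
    (j : τ) : liftInl P₂ A Q (Sum.inr j) = 0 := rfl

omit [Fintype σ] [Fintype τ] in
/-- `𝒬_{x_i} = 0` for the lift of `A·G_2(y)`. [cite: DuqueFrancoVillaflor2025Join, Theorem 1.3 (proof; = Theorem 4.1 of arXiv v4)] -/
@[simp] theorem liftInr_inl (P₁ : MvPolynomial σ K) (A : MvPolynomial (σ ⊕ τ) K) (R : τ → MvPolynomial τ K)
    (i : σ) : liftInr P₁ A R (Sum.inl i) = 0 := rfl

omit [Fintype σ] [Fintype τ] in
/-- `𝒬_{y_j} = A·P_{Z_1}·R_j`. [cite: DuqueFrancoVillaflor2025Join, Theorem 1.3 (proof; = Theorem 4.1 of arXiv v4)] -/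
@[simp] theorem liftInr_inr (P₁ : MvPolynomial σ K) (A : MvPolynomial (σ ⊕ τ) K) (R : τ → MvPolynomial τ K)
    (j : τ) : liftInr P₁ A R (Sum.inr j) = A * rename Sum.inl P₁ * rename Sum.inr (R j) := rfl

variable {f g}

/-- **The lift of `A·G_1(x)` is legitimate**: `(A G_1)·(P_{Z_1} P_{Z_2}) = Σ_z 𝒬_z ∂(f+g)/∂z`.
[cite: DuqueFrancoVillaflor2025Join, Theorem 1.3 (proof; = Theorem 4.1 of arXiv v4)] -/
theorem mul_eq_sum_liftInl {G₁ P₁ : MvPolynomial σ K} {Q : σ → MvPolynomial σ K}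
    (hQ : G₁ * P₁ = ∑ i, Q i * pderiv i f) (P₂ : MvPolynomial τ K) (A : MvPolynomial (σ ⊕ τ) K) :
    A * rename Sum.inl G₁ * (rename Sum.inl P₁ * rename Sum.inr P₂) =
      ∑ z, liftInl P₂ A Q z * pderiv z (joinPoly f g) := by
  rw [Fintype.sum_sum_type]
  simp only [liftInl_inl, liftInl_inr, zero_mul, Finset.sum_const_zero, add_zero, pderiv_inl_joinPoly]
  have h := congrArg (rename (Sum.inl : σ → σ ⊕ τ) (R := K)) hQ
  rw [map_mul, map_sum] at h
  simp only [map_mul] at h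
  calc A * rename Sum.inl G₁ * (rename Sum.inl P₁ * rename Sum.inr P₂)
      = A * rename Sum.inr P₂ * (rename Sum.inl G₁ * rename Sum.inl P₁) := by ring
    _ = A * rename Sum.inr P₂ * ∑ i, rename Sum.inl (Q i) * rename Sum.inl (pderiv i f) := by rw [h]
    _ = ∑ i, A * rename Sum.inr P₂ * rename Sum.inl (Q i) * rename Sum.inl (pderiv i f) := by
      rw [Finset.mul_sum]
      exact Finset.sum_congr rfl fun i _ => by ring

/-- **The lift of `A·G_2(y)` is legitimate**: `(A G_2)·(P_{Z_1} P_{Z_2}) = Σ_z 𝒬_z ∂(f+g)/∂z`.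
[cite: DuqueFrancoVillaflor2025Join, Theorem 1.3 (proof; = Theorem 4.1 of arXiv v4)] -/
theorem mul_eq_sum_liftInr {G₂ P₂ : MvPolynomial τ K} {R : τ → MvPolynomial τ K}
    (hR : G₂ * P₂ = ∑ j, R j * pderiv j g) (P₁ : MvPolynomial σ K) (A : MvPolynomial (σ ⊕ τ) K) :
    A * rename Sum.inr G₂ * (rename Sum.inl P₁ * rename Sum.inr P₂) =
      ∑ z, liftInr P₁ A R z * pderiv z (joinPoly f g) := by
  rw [Fintype.sum_sum_type]
  simp only [liftInr_inl, liftInr_inr, zero_mul, Finset.sum_const_zero, zero_add, pderiv_inr_joinPoly]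
  have h := congrArg (rename (Sum.inr : τ → σ ⊕ τ) (R := K)) hR
  rw [map_mul, map_sum] at h
  simp only [map_mul] at h
  calc A * rename Sum.inr G₂ * (rename Sum.inl P₁ * rename Sum.inr P₂)
      = A * rename Sum.inl P₁ * (rename Sum.inr G₂ * rename Sum.inr P₂) := by ring
    _ = A * rename Sum.inl P₁ * ∑ j, rename Sum.inr (R j) * rename Sum.inr (pderiv j g) := by rw [h]
    _ = ∑ j, A * rename Sum.inl P₁ * rename Sum.inr (R j) * rename Sum.inr (pderiv j g) := by
      rw [Finset.mul_sum]
      exact Finset.sum_congr rfl fun j _ => by ring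

/-- **The lift of `G = A_1G_1 + A_2G_2` is legitimate**: `G·P_{Z_1}P_{Z_2} = Σ_z (𝒬^{(1)} + 𝒬^{(2)})_z ∂(f+g)/∂z`.
[cite: DuqueFrancoVillaflor2025Join, Theorem 1.3 (= Theorem 4.1 of arXiv v4)] -/
theorem join_mul_eq_sum_lift {G₁ P₁ : MvPolynomial σ K} {Q : σ → MvPolynomial σ K}
    {G₂ P₂ : MvPolynomial τ K} {R : τ → MvPolynomial τ K}
    (hQ : G₁ * P₁ = ∑ i, Q i * pderiv i f) (hR : G₂ * P₂ = ∑ j, R j * pderiv j g)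
    (A₁ A₂ : MvPolynomial (σ ⊕ τ) K) :
    (A₁ * rename Sum.inl G₁ + A₂ * rename Sum.inr G₂) * (rename Sum.inl P₁ * rename Sum.inr P₂) =
      ∑ z, (liftInl P₂ A₁ Q + liftInr P₁ A₂ R) z * pderiv z (joinPoly f g) := by
  simp only [Pi.add_apply, add_mul, Finset.sum_add_distrib]
  rw [mul_eq_sum_liftInl hQ, mul_eq_sum_liftInr hR]

/-! ### The four elementary cases of eq. (eqQFFjoin) — exact polynomial identities -/

/-- **Both generators from `x`**: for `G = A·G_1(x)`, `H = B·H_1(x)` with the lifts above,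
`q(G,H) = A B P_{Z_2} · q_1(G_1,H_1)(x) + B P_{Z_2} Σ_i (H_1Q_i − G_1S_i)(x) ∂A/∂x_i` EXACTLY
(the second group is the printed "`B_1P_{Z_2}Σ_i (H_1Q_i − G_1S_i) ∂A_1/∂x_i`").
[cite: DuqueFrancoVillaflor2025Join, Theorem 1.3 (proof, display after "it follows by (eqQFF) that"; = Theorem 4.1 of arXiv v4)] -/
theorem macleanForm_inl_inl (G₁ H₁ : MvPolynomial σ K) (Q S : σ → MvPolynomial σ K) (P₂ : MvPolynomial τ K)
    (A B : MvPolynomial (σ ⊕ τ) K) :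
    macleanForm (A * rename Sum.inl G₁) (B * rename Sum.inl H₁) (liftInl P₂ A Q) (liftInl P₂ B S) =
      A * B * rename Sum.inr P₂ * rename Sum.inl (macleanForm G₁ H₁ Q S) +
        B * rename Sum.inr P₂ * ∑ i, (rename Sum.inl H₁ * rename Sum.inl (Q i) -
          rename Sum.inl G₁ * rename Sum.inl (S i)) * pderiv (Sum.inl i) A := by
  rw [macleanForm, Fintype.sum_sum_type]
  simp only [liftInl_inl, liftInl_inr, map_zero, mul_zero, zero_mul, sub_zero, Finset.sum_const_zero,
    add_zero]
  rw [macleanForm, map_sum]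
  simp only [map_sub, map_mul, pderiv_mul, pderiv_inl_rename_inr, pderiv_inl_rename_inl, mul_zero, add_zero]
  rw [Finset.mul_sum, Finset.mul_sum, ← Finset.sum_add_distrib]
  exact Finset.sum_congr rfl fun i _ => by ring

/-- **Both generators from `y`**: for `G = A·G_2(y)`, `H = B·H_2(y)`,
`q(G,H) = A B P_{Z_1} · q_2(G_2,H_2)(y) + B P_{Z_1} Σ_j (H_2R_j − G_2T_j)(y) ∂A/∂y_j` EXACTLY.
[cite: DuqueFrancoVillaflor2025Join, Theorem 1.3 (proof; = Theorem 4.1 of arXiv v4)] -/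
theorem macleanForm_inr_inr (G₂ H₂ : MvPolynomial τ K) (R T : τ → MvPolynomial τ K) (P₁ : MvPolynomial σ K)
    (A B : MvPolynomial (σ ⊕ τ) K) :
    macleanForm (A * rename Sum.inr G₂) (B * rename Sum.inr H₂) (liftInr P₁ A R) (liftInr P₁ B T) =
      A * B * rename Sum.inl P₁ * rename Sum.inr (macleanForm G₂ H₂ R T) +
        B * rename Sum.inl P₁ * ∑ j, (rename Sum.inr H₂ * rename Sum.inr (R j) -
          rename Sum.inr G₂ * rename Sum.inr (T j)) * pderiv (Sum.inr j) A := by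
  rw [macleanForm, Fintype.sum_sum_type]
  simp only [liftInr_inl, liftInr_inr, map_zero, mul_zero, zero_mul, sub_zero, Finset.sum_const_zero,
    zero_add]
  rw [macleanForm, map_sum]
  simp only [map_sub, map_mul, pderiv_mul, pderiv_inr_rename_inl, pderiv_inr_rename_inr, mul_zero, add_zero]
  rw [Finset.mul_sum, Finset.mul_sum, ← Finset.sum_add_distrib]
  exact Finset.sum_congr rfl fun j _ => by ring

/-- **Mixed case `G = A·G_1(x)`, `H = B·H_2(y)`**:
`q(G,H) = B·(H_2P_{Z_2})(y)·Σ_i ∂(A Q_i)/∂x_i − B·(G_1P_{Z_1})(x)·Σ_j T_j ∂A/∂y_j` EXACTLY — both groups lie in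
`J^{f+g}` (these are the terms the printed display leaves out).
[cite: DuqueFrancoVillaflor2025Join, Theorem 1.3 (proof; = Theorem 4.1 of arXiv v4)] -/
theorem macleanForm_inl_inr (G₁ P₁ : MvPolynomial σ K) (H₂ P₂ : MvPolynomial τ K) (Q : σ → MvPolynomial σ K)
    (T : τ → MvPolynomial τ K) (A B : MvPolynomial (σ ⊕ τ) K) :
    macleanForm (A * rename Sum.inl G₁) (B * rename Sum.inr H₂) (liftInl P₂ A Q) (liftInr P₁ B T) =
      B * (rename Sum.inr H₂ * rename Sum.inr P₂) * ∑ i, pderiv (Sum.inl i) (A * rename Sum.inl (Q i)) -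
        B * (rename Sum.inl G₁ * rename Sum.inl P₁) * ∑ j, rename Sum.inr (T j) * pderiv (Sum.inr j) A := by
  rw [macleanForm, Fintype.sum_sum_type]
  simp only [liftInl_inl, liftInl_inr, liftInr_inl, liftInr_inr, map_zero, mul_zero, zero_mul, sub_zero,
    zero_sub, pderiv_mul, pderiv_inl_rename_inr, pderiv_inr_rename_inl, add_zero]
  rw [sub_eq_add_neg, Finset.mul_sum, Finset.mul_sum, ← Finset.sum_neg_distrib]
  exact congrArg₂ (· + ·) (Finset.sum_congr rfl fun i _ => by ring) (Finset.sum_congr rfl fun j _ => by ring)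

/-- **Mixed case `G = A·G_2(y)`, `H = B·H_1(x)`**:
`q(G,H) = B·(H_1P_{Z_1})(x)·Σ_j ∂(A R_j)/∂y_j − B·(G_2P_{Z_2})(y)·Σ_i S_i ∂A/∂x_i` EXACTLY.
[cite: DuqueFrancoVillaflor2025Join, Theorem 1.3 (proof; = Theorem 4.1 of arXiv v4)] -/
theorem macleanForm_inr_inl (G₂ P₂ : MvPolynomial τ K) (H₁ P₁ : MvPolynomial σ K) (R : τ → MvPolynomial τ K)
    (S : σ → MvPolynomial σ K) (A B : MvPolynomial (σ ⊕ τ) K) :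
    macleanForm (A * rename Sum.inr G₂) (B * rename Sum.inl H₁) (liftInr P₁ A R) (liftInl P₂ B S) =
      B * (rename Sum.inl H₁ * rename Sum.inl P₁) * ∑ j, pderiv (Sum.inr j) (A * rename Sum.inr (R j)) -
        B * (rename Sum.inr G₂ * rename Sum.inr P₂) * ∑ i, rename Sum.inl (S i) * pderiv (Sum.inl i) A := by
  rw [macleanForm, Fintype.sum_sum_type]
  simp only [liftInl_inl, liftInl_inr, liftInr_inl, liftInr_inr, map_zero, mul_zero, zero_mul, sub_zero,
    zero_sub, pderiv_mul, pderiv_inl_rename_inr, pderiv_inr_rename_inl, add_zero]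
  rw [sub_eq_neg_add, Finset.mul_sum, Finset.mul_sum, ← Finset.sum_neg_distrib]
  exact congrArg₂ (· + ·) (Finset.sum_congr rfl fun i _ => by ring) (Finset.sum_congr rfl fun j _ => by ring)

/-! ### The four cases modulo `J^{f+g}` -/

/-- Same side `x`, modulo `J^{f+g}`: given the Koszul memberships `H_1Q_i − G_1S_i ∈ J^f`,
`q(A G_1, B H_1) − A B P_{Z_2} q_1(G_1,H_1) ∈ J^{f+g}`.
[cite: DuqueFrancoVillaflor2025Join, Theorem 1.3, eq. (eqQFFjoin) (= Theorem 4.1 of arXiv v4)] -/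
theorem macleanForm_inl_inl_sub_mem {G₁ H₁ : MvPolynomial σ K} {Q S : σ → MvPolynomial σ K}
    (hK : ∀ i, H₁ * Q i - G₁ * S i ∈ Ideal.span (Set.range fun i => pderiv i f))
    (P₂ : MvPolynomial τ K) (A B : MvPolynomial (σ ⊕ τ) K) :
    macleanForm (A * rename Sum.inl G₁) (B * rename Sum.inl H₁) (liftInl P₂ A Q) (liftInl P₂ B S) -
        A * B * rename Sum.inr P₂ * rename Sum.inl (macleanForm G₁ H₁ Q S) ∈
      Ideal.span (Set.range fun z => pderiv z (joinPoly f g)) := by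
  rw [macleanForm_inl_inl, add_sub_cancel_left]
  refine Ideal.mul_mem_left _ _ (Ideal.sum_mem _ fun i _ => Ideal.mul_mem_right _ _ ?_)
  rw [← map_mul, ← map_mul, ← map_sub]
  exact rename_inl_mem_span_pderiv_joinPoly f g (hK i)

/-- Same side `y`, modulo `J^{f+g}`: given `H_2R_j − G_2T_j ∈ J^g`,
`q(A G_2, B H_2) − A B P_{Z_1} q_2(G_2,H_2) ∈ J^{f+g}`.
[cite: DuqueFrancoVillaflor2025Join, Theorem 1.3, eq. (eqQFFjoin) (= Theorem 4.1 of arXiv v4)] -/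
theorem macleanForm_inr_inr_sub_mem {G₂ H₂ : MvPolynomial τ K} {R T : τ → MvPolynomial τ K}
    (hK : ∀ j, H₂ * R j - G₂ * T j ∈ Ideal.span (Set.range fun j => pderiv j g))
    (P₁ : MvPolynomial σ K) (A B : MvPolynomial (σ ⊕ τ) K) :
    macleanForm (A * rename Sum.inr G₂) (B * rename Sum.inr H₂) (liftInr P₁ A R) (liftInr P₁ B T) -
        A * B * rename Sum.inl P₁ * rename Sum.inr (macleanForm G₂ H₂ R T) ∈
      Ideal.span (Set.range fun z => pderiv z (joinPoly f g)) := by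
  rw [macleanForm_inr_inr, add_sub_cancel_left]
  refine Ideal.mul_mem_left _ _ (Ideal.sum_mem _ fun j _ => Ideal.mul_mem_right _ _ ?_)
  rw [← map_mul, ← map_mul, ← map_sub]
  exact rename_inr_mem_span_pderiv_joinPoly f g (hK j)

/-- Mixed case `(x, y)`, modulo `J^{f+g}`: `q(A G_1, B H_2) ∈ J^{f+g}` (no cross term), for legitimate lifts
`G_1P_{Z_1} = Σ Q_i ∂_if`, `H_2P_{Z_2} = Σ T_j ∂_jg`.
[cite: DuqueFrancoVillaflor2025Join, Theorem 1.3, eq. (eqQFFjoin) (= Theorem 4.1 of arXiv v4)] -/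
theorem macleanForm_inl_inr_mem {G₁ P₁ : MvPolynomial σ K} {H₂ P₂ : MvPolynomial τ K}
    {Q : σ → MvPolynomial σ K} {T : τ → MvPolynomial τ K}
    (hQ : G₁ * P₁ = ∑ i, Q i * pderiv i f) (hT : H₂ * P₂ = ∑ j, T j * pderiv j g)
    (A B : MvPolynomial (σ ⊕ τ) K) :
    macleanForm (A * rename Sum.inl G₁) (B * rename Sum.inr H₂) (liftInl P₂ A Q) (liftInr P₁ B T) ∈
      Ideal.span (Set.range fun z => pderiv z (joinPoly f g)) := by
  rw [macleanForm_inl_inr, ← map_mul, ← map_mul]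
  refine Ideal.sub_mem _ (Ideal.mul_mem_right _ _ (Ideal.mul_mem_left _ _ ?_))
    (Ideal.mul_mem_right _ _ (Ideal.mul_mem_left _ _ ?_))
  · exact rename_inr_mem_of_eq_sum f g hT
  · exact rename_inl_mem_of_eq_sum f g hQ

/-- Mixed case `(y, x)`, modulo `J^{f+g}`: `q(A G_2, B H_1) ∈ J^{f+g}`.
[cite: DuqueFrancoVillaflor2025Join, Theorem 1.3, eq. (eqQFFjoin) (= Theorem 4.1 of arXiv v4)] -/
theorem macleanForm_inr_inl_mem {G₂ P₂ : MvPolynomial τ K} {H₁ P₁ : MvPolynomial σ K}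
    {R : τ → MvPolynomial τ K} {S : σ → MvPolynomial σ K}
    (hR : G₂ * P₂ = ∑ j, R j * pderiv j g) (hS : H₁ * P₁ = ∑ i, S i * pderiv i f)
    (A B : MvPolynomial (σ ⊕ τ) K) :
    macleanForm (A * rename Sum.inr G₂) (B * rename Sum.inl H₁) (liftInr P₁ A R) (liftInl P₂ B S) ∈
      Ideal.span (Set.range fun z => pderiv z (joinPoly f g)) := by
  rw [macleanForm_inr_inl, ← map_mul, ← map_mul]
  refine Ideal.sub_mem _ (Ideal.mul_mem_right _ _ (Ideal.mul_mem_left _ _ ?_))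
    (Ideal.mul_mem_right _ _ (Ideal.mul_mem_left _ _ ?_))
  · exact rename_inl_mem_of_eq_sum f g hS
  · exact rename_inr_mem_of_eq_sum f g hR

/-! ### Theorem 1.3, eq. (eqQFFjoin) -/

/-- **Theorem 1.3, eq. (eqQFFjoin) [= Thm. 4.1 of arXiv v4], given the Koszul memberships.** For
`G = A_1G_1 + A_2G_2`, `H = B_1H_1 + B_2H_2` with `G_1, H_1 ∈ (J^f : P_{Z_1})`, `G_2, H_2 ∈ (J^g : P_{Z_2})`
lifted by `G_1P_{Z_1} = ΣQ_i∂_if`, `H_1P_{Z_1} = ΣS_i∂_if`, `G_2P_{Z_2} = ΣR_j∂_jg`, `H_2P_{Z_2} = ΣT_j∂_jg`, and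
Maclean's form of `G, H` computed with the induced lifts of `G·P_{Z_1}P_{Z_2}`, `H·P_{Z_1}P_{Z_2}`:
`q(G,H) − (A_1B_1P_{Z_2} q_1(G_1,H_1) + A_2B_2P_{Z_1} q_2(G_2,H_2)) ∈ J^{f+g}`
provided `H_1Q_i − G_1S_i ∈ J^f` and `H_2R_j − G_2T_j ∈ J^g` ("it follows by the exactness of the Koszul
complex that `H_1Q_i − G_1S_i ∈ J^f` and `H_2R_j − G_2T_j ∈ J^g`, and so we obtain (eqQFFjoin)").
[cite: DuqueFrancoVillaflor2025Join, Theorem 1.3, eq. (eqQFFjoin) (= Theorem 4.1 of arXiv v4)] -/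
theorem macleanForm_join_sub_mem_of_koszul {G₁ H₁ P₁ : MvPolynomial σ K} {G₂ H₂ P₂ : MvPolynomial τ K}
    {Q S : σ → MvPolynomial σ K} {R T : τ → MvPolynomial τ K}
    (hQ : G₁ * P₁ = ∑ i, Q i * pderiv i f) (hS : H₁ * P₁ = ∑ i, S i * pderiv i f)
    (hR : G₂ * P₂ = ∑ j, R j * pderiv j g) (hT : H₂ * P₂ = ∑ j, T j * pderiv j g)
    (hK₁ : ∀ i, H₁ * Q i - G₁ * S i ∈ Ideal.span (Set.range fun i => pderiv i f))
    (hK₂ : ∀ j, H₂ * R j - G₂ * T j ∈ Ideal.span (Set.range fun j => pderiv j g))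
    (A₁ A₂ B₁ B₂ : MvPolynomial (σ ⊕ τ) K) :
    macleanForm (A₁ * rename Sum.inl G₁ + A₂ * rename Sum.inr G₂) (B₁ * rename Sum.inl H₁ + B₂ * rename Sum.inr H₂)
          (liftInl P₂ A₁ Q + liftInr P₁ A₂ R) (liftInl P₂ B₁ S + liftInr P₁ B₂ T) -
        (A₁ * B₁ * rename Sum.inr P₂ * rename Sum.inl (macleanForm G₁ H₁ Q S) +
          A₂ * B₂ * rename Sum.inl P₁ * rename Sum.inr (macleanForm G₂ H₂ R T)) ∈
      Ideal.span (Set.range fun z => pderiv z (joinPoly f g)) := by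
  rw [macleanForm_add_left, macleanForm_add_right, macleanForm_add_right]
  have e : macleanForm (A₁ * rename Sum.inl G₁) (B₁ * rename Sum.inl H₁) (liftInl P₂ A₁ Q) (liftInl P₂ B₁ S) +
        macleanForm (A₁ * rename Sum.inl G₁) (B₂ * rename Sum.inr H₂) (liftInl P₂ A₁ Q) (liftInr P₁ B₂ T) +
      (macleanForm (A₂ * rename Sum.inr G₂) (B₁ * rename Sum.inl H₁) (liftInr P₁ A₂ R) (liftInl P₂ B₁ S) +
        macleanForm (A₂ * rename Sum.inr G₂) (B₂ * rename Sum.inr H₂) (liftInr P₁ A₂ R) (liftInr P₁ B₂ T)) -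
      (A₁ * B₁ * rename Sum.inr P₂ * rename Sum.inl (macleanForm G₁ H₁ Q S) +
        A₂ * B₂ * rename Sum.inl P₁ * rename Sum.inr (macleanForm G₂ H₂ R T)) =
      (macleanForm (A₁ * rename Sum.inl G₁) (B₁ * rename Sum.inl H₁) (liftInl P₂ A₁ Q) (liftInl P₂ B₁ S) -
          A₁ * B₁ * rename Sum.inr P₂ * rename Sum.inl (macleanForm G₁ H₁ Q S)) +
        macleanForm (A₁ * rename Sum.inl G₁) (B₂ * rename Sum.inr H₂) (liftInl P₂ A₁ Q) (liftInr P₁ B₂ T) +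
        macleanForm (A₂ * rename Sum.inr G₂) (B₁ * rename Sum.inl H₁) (liftInr P₁ A₂ R) (liftInl P₂ B₁ S) +
        (macleanForm (A₂ * rename Sum.inr G₂) (B₂ * rename Sum.inr H₂) (liftInr P₁ A₂ R) (liftInr P₁ B₂ T) -
          A₂ * B₂ * rename Sum.inl P₁ * rename Sum.inr (macleanForm G₂ H₂ R T)) := by
    ring
  rw [e]
  exact Ideal.add_mem _ (Ideal.add_mem _ (Ideal.add_mem _ (macleanForm_inl_inl_sub_mem hK₁ P₂ A₁ B₁)
    (macleanForm_inl_inr_mem hQ hT A₁ B₂)) (macleanForm_inr_inl_mem hR hS A₂ B₁))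
    (macleanForm_inr_inr_sub_mem hK₂ P₁ A₂ B₂)

/-- **Theorem 1.3, eq. (eqQFFjoin) [= Thm. 4.1 of arXiv v4] for smooth `X_1 = {f = 0}`, `X_2 = {g = 0}`**
(forms of degrees `≥ 2` with Artinian Gorenstein Jacobian ideals, the tree's rendering of smoothness): with
`q`, `q_1`, `q_2` Maclean's bilinear forms of `J(Z_1,Z_2)`, `Z_1`, `Z_2` and `G = A_1G_1 + A_2G_2`,
`H = B_1H_1 + B_2H_2` (`G_1, H_1 ∈ J^{f,[Z_1]}`, `G_2, H_2 ∈ J^{g,[Z_2]}`, ANY lifts),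
**`q(G,H) ≡ A_1B_1P_{Z_2} q_1(G_1,H_1) + A_2B_2P_{Z_1} q_2(G_2,H_2)` modulo `J^{f+g}`** (hence in
`R^{f+g}/⟨P_{Z_1}P_{Z_2}⟩`). [cite: DuqueFrancoVillaflor2025Join, Theorem 1.3, eq. (eqQFFjoin) (= Theorem 4.1 of arXiv v4)] -/
theorem macleanForm_join_sub_mem {d₁ d₂ s₁ s₂ : ℕ} (hf : f.IsHomogeneous d₁) (hd₁ : 2 ≤ d₁)
    (hJf : IsArtinianGorenstein (Ideal.span (Set.range fun i => pderiv i f)) s₁)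
    (hg : g.IsHomogeneous d₂) (hd₂ : 2 ≤ d₂)
    (hJg : IsArtinianGorenstein (Ideal.span (Set.range fun j => pderiv j g)) s₂)
    {G₁ H₁ P₁ : MvPolynomial σ K} {G₂ H₂ P₂ : MvPolynomial τ K}
    {Q S : σ → MvPolynomial σ K} {R T : τ → MvPolynomial τ K}
    (hQ : G₁ * P₁ = ∑ i, Q i * pderiv i f) (hS : H₁ * P₁ = ∑ i, S i * pderiv i f)
    (hR : G₂ * P₂ = ∑ j, R j * pderiv j g) (hT : H₂ * P₂ = ∑ j, T j * pderiv j g)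
    (A₁ A₂ B₁ B₂ : MvPolynomial (σ ⊕ τ) K) :
    macleanForm (A₁ * rename Sum.inl G₁ + A₂ * rename Sum.inr G₂) (B₁ * rename Sum.inl H₁ + B₂ * rename Sum.inr H₂)
          (liftInl P₂ A₁ Q + liftInr P₁ A₂ R) (liftInl P₂ B₁ S + liftInr P₁ B₂ T) -
        (A₁ * B₁ * rename Sum.inr P₂ * rename Sum.inl (macleanForm G₁ H₁ Q S) +
          A₂ * B₂ * rename Sum.inl P₁ * rename Sum.inr (macleanForm G₂ H₂ R T)) ∈
      Ideal.span (Set.range fun z => pderiv z (joinPoly f g)) :=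
  macleanForm_join_sub_mem_of_koszul hQ hS hR hT
    (sub_mem_span_pderiv_of_lifts (hasKoszulSyzygies_pderiv_of_isArtinianGorenstein hf hd₁ hJf) hQ hS)
    (sub_mem_span_pderiv_of_lifts (hasKoszulSyzygies_pderiv_of_isArtinianGorenstein hg hd₂ hJg) hR hT)
    A₁ A₂ B₁ B₂

/-- **… and `q` itself is well defined there**: the partials of `f + g` have only trivial syzygies too
(`J^{f+g} = J^f S + J^g S` is Artinian Gorenstein of socle `soc(J^f) + soc(J^g)`, tree
`isArtinianGorenstein_join`), so by `macleanForm_sub_macleanForm_mem_of_lifts` the left side of (eqQFFjoin)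
does not depend on the lifts modulo `J^{f+g}` (here `f`, `g` of the same degree `d ≥ 2`, as in the paper).
[cite: DuqueFrancoVillaflor2025Join, Theorem 1.1 (proof), Theorem 2.1 (Maclean)] -/
theorem hasKoszulSyzygies_pderiv_joinPoly {d s₁ s₂ : ℕ} (hf : f.IsHomogeneous d) (hg : g.IsHomogeneous d)
    (hd : 2 ≤ d) (hJf : IsArtinianGorenstein (Ideal.span (Set.range fun i => pderiv i f)) s₁)
    (hJg : IsArtinianGorenstein (Ideal.span (Set.range fun j => pderiv j g)) s₂) :
    HasKoszulSyzygies fun z => pderiv z (joinPoly f g) := by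
  refine hasKoszulSyzygies_pderiv_of_isArtinianGorenstein (isHomogeneous_joinPoly f g hf hg) hd
    (s := s₁ + s₂) ?_
  rw [span_pderiv_joinPoly]
  exact isArtinianGorenstein_join hJf hJg

end Join

/-! ## §3. Theorem 1.3 (i): if `q_1` and `q_2` vanish then `q` vanishes — generator form -/

section Vanishing

variable {σ : Type v} {τ : Type w} [Fintype σ] [Fintype τ] {f : MvPolynomial σ K} {g : MvPolynomial τ K}

/-- `P_{Z_2}(y)·u(x) ∈ J^{f+g} + ⟨P_{Z_1}P_{Z_2}⟩` for `u ∈ J^f + ⟨P_{Z_1}⟩` (the class `P_{Z_2}·q_1(G_1,H_1)` of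
(eqQFFjoin) vanishes in `R^{f+g}/⟨P_{Z_1}P_{Z_2}⟩` when `q_1(G_1,H_1)` does in `R^f/⟨P_{Z_1}⟩`).
[cite: DuqueFrancoVillaflor2025Join, Theorem 1.3 (i) (proof: "direct computation in the generators"; = Theorem 4.1 of arXiv v4)] -/
theorem rename_inr_mul_rename_inl_mem_sup (g : MvPolynomial τ K) {u P₁ : MvPolynomial σ K}
    (P₂ : MvPolynomial τ K) (hu : u ∈ Ideal.span (Set.range fun i => pderiv i f) ⊔ Ideal.span {P₁}) :
    rename Sum.inr P₂ * rename Sum.inl u ∈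
      Ideal.span (Set.range fun z => pderiv z (joinPoly f g)) ⊔
        Ideal.span {rename Sum.inl P₁ * rename Sum.inr P₂} := by
  obtain ⟨j, hj, p, hp, rfl⟩ := Submodule.mem_sup.mp hu
  obtain ⟨c, rfl⟩ := Ideal.mem_span_singleton'.mp hp
  rw [map_add, mul_add, map_mul]
  exact Ideal.add_mem _
    (Ideal.mem_sup_left (Ideal.mul_mem_left _ _ (rename_inl_mem_span_pderiv_joinPoly f g hj)))
    (Ideal.mem_sup_right (Ideal.mem_span_singleton'.mpr ⟨rename Sum.inl c * 1, by ring⟩))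

/-- `P_{Z_1}(x)·v(y) ∈ J^{f+g} + ⟨P_{Z_1}P_{Z_2}⟩` for `v ∈ J^g + ⟨P_{Z_2}⟩`.
[cite: DuqueFrancoVillaflor2025Join, Theorem 1.3 (i) (proof; = Theorem 4.1 of arXiv v4)] -/
theorem rename_inl_mul_rename_inr_mem_sup (f : MvPolynomial σ K) {v P₂ : MvPolynomial τ K}
    (P₁ : MvPolynomial σ K) (hv : v ∈ Ideal.span (Set.range fun j => pderiv j g) ⊔ Ideal.span {P₂}) :
    rename Sum.inl P₁ * rename Sum.inr v ∈
      Ideal.span (Set.range fun z => pderiv z (joinPoly f g)) ⊔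
        Ideal.span {rename Sum.inl P₁ * rename Sum.inr P₂} := by
  obtain ⟨j, hj, p, hp, rfl⟩ := Submodule.mem_sup.mp hv
  obtain ⟨c, rfl⟩ := Ideal.mem_span_singleton'.mp hp
  rw [map_add, mul_add, map_mul]
  exact Ideal.add_mem _
    (Ideal.mem_sup_left (Ideal.mul_mem_left _ _ (rename_inr_mem_span_pderiv_joinPoly f g hj)))
    (Ideal.mem_sup_right (Ideal.mem_span_singleton'.mpr ⟨rename Sum.inr c * 1, by ring⟩))

omit [Fintype σ] [Fintype τ] in
/-- Elements of `⟨𝒢_1(x)⟩S + ⟨𝒢_2(y)⟩S` are finite combinations `Σ_k A_k a_k(x) + Σ_k A'_k b_k(y)` with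
`a_k ∈ 𝒢_1`, `b_k ∈ 𝒢_2` ("the generators of `J^{f+g,[J(Z_1,Z_2)]}` which are generators of either `J^{f,[Z_1]}` or
`J^{g,[Z_2]}`"). [cite: DuqueFrancoVillaflor2025Join, Theorem 1.3 (i) (proof; = Theorem 4.1 of arXiv v4)] -/
theorem exists_sum_eq_of_mem_map_span_sup {𝒢₁ : Set (MvPolynomial σ K)} {𝒢₂ : Set (MvPolynomial τ K)}
    {G : MvPolynomial (σ ⊕ τ) K}
    (hG : G ∈ (Ideal.span 𝒢₁).map (rename Sum.inl : MvPolynomial σ K →ₐ[K] MvPolynomial (σ ⊕ τ) K) ⊔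
      (Ideal.span 𝒢₂).map (rename Sum.inr : MvPolynomial τ K →ₐ[K] MvPolynomial (σ ⊕ τ) K)) :
    ∃ (n₁ : ℕ) (A₁ : Fin n₁ → MvPolynomial (σ ⊕ τ) K) (a : Fin n₁ → MvPolynomial σ K) (_ : ∀ k, a k ∈ 𝒢₁)
      (n₂ : ℕ) (A₂ : Fin n₂ → MvPolynomial (σ ⊕ τ) K) (b : Fin n₂ → MvPolynomial τ K) (_ : ∀ k, b k ∈ 𝒢₂),
      G = ∑ k, A₁ k * rename Sum.inl (a k) + ∑ k, A₂ k * rename Sum.inr (b k) := by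
  obtain ⟨G₁, hG₁, G₂, hG₂, rfl⟩ := Submodule.mem_sup.mp hG
  rw [Ideal.map_span] at hG₁ hG₂
  obtain ⟨n₁, c₁, x₁, hx₁⟩ := Submodule.mem_span_set'.mp hG₁
  obtain ⟨n₂, c₂, x₂, hx₂⟩ := Submodule.mem_span_set'.mp hG₂
  have h1 : ∀ k, ∃ a ∈ 𝒢₁, rename Sum.inl a = (x₁ k : MvPolynomial (σ ⊕ τ) K) := fun k => (x₁ k).2
  have h2 : ∀ k, ∃ b ∈ 𝒢₂, rename Sum.inr b = (x₂ k : MvPolynomial (σ ⊕ τ) K) := fun k => (x₂ k).2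
  choose a ha hax using h1
  choose b hb hbx using h2
  refine ⟨n₁, c₁, a, ha, n₂, c₂, b, hb, ?_⟩
  rw [← hx₁, ← hx₂]
  exact congrArg₂ (· + ·) (Finset.sum_congr rfl fun k _ => by rw [smul_eq_mul, hax k])
    (Finset.sum_congr rfl fun k _ => by rw [smul_eq_mul, hbx k])

/-- **The computation behind Theorem 1.3 (i)**, for arbitrary subsets `𝒢_1 ⊆ (J^f : P_{Z_1})`,
`𝒢_2 ⊆ (J^g : P_{Z_2})`: if `q_1(a,b) ∈ J^f + ⟨P_{Z_1}⟩` for all `a, b ∈ 𝒢_1` (all lifts) and likewise for `q_2`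
on `𝒢_2`, then `q(G,H) ∈ J^{f+g} + ⟨P_{Z_1}P_{Z_2}⟩` for all `G, H ∈ ⟨𝒢_1(x)⟩ + ⟨𝒢_2(y)⟩` and all lifts — expand
`G = Σ A_k a_k(x) + Σ A'_k a'_k(y)`, `H` likewise, by bilinearity; the four blocks are the four atomic cases of
(eqQFFjoin) (`macleanForm_inl_inl_sub_mem`, `…_inl_inr_mem`, `…_inr_inl_mem`, `…_inr_inr_sub_mem`), and the
given lifts are exchanged for the induced ones modulo `J^{f+g}` (`macleanForm_sub_macleanForm_mem_of_lifts'`).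
"… by a direct computation in the generators of `J^{f+g,[J(Z_1,Z_2)]}` which are generators of either
`J^{f,[Z_1]}` or `J^{g,[Z_2]}`." [cite: DuqueFrancoVillaflor2025Join, Theorem 1.3 (i) (proof; = Theorem 4.1 (i) of arXiv v4)] -/
theorem macleanForm_join_mem_of_mem_span {d s₁ s₂ : ℕ} (hf : f.IsHomogeneous d) (hg : g.IsHomogeneous d)
    (hd : 2 ≤ d) (hJf : IsArtinianGorenstein (Ideal.span (Set.range fun i => pderiv i f)) s₁)
    (hJg : IsArtinianGorenstein (Ideal.span (Set.range fun j => pderiv j g)) s₂)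
    {P₁ : MvPolynomial σ K} {P₂ : MvPolynomial τ K} {𝒢₁ : Set (MvPolynomial σ K)} {𝒢₂ : Set (MvPolynomial τ K)}
    (h𝒢₁ : ∀ a ∈ 𝒢₁, a ∈ (Ideal.span (Set.range fun i => pderiv i f)).colon {P₁})
    (h𝒢₂ : ∀ b ∈ 𝒢₂, b ∈ (Ideal.span (Set.range fun j => pderiv j g)).colon {P₂})
    (hq₁ : ∀ a ∈ 𝒢₁, ∀ b ∈ 𝒢₁, ∀ Q S : σ → MvPolynomial σ K,
      a * P₁ = ∑ i, Q i * pderiv i f → b * P₁ = ∑ i, S i * pderiv i f →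
        macleanForm a b Q S ∈ Ideal.span (Set.range fun i => pderiv i f) ⊔ Ideal.span {P₁})
    (hq₂ : ∀ a ∈ 𝒢₂, ∀ b ∈ 𝒢₂, ∀ R T : τ → MvPolynomial τ K,
      a * P₂ = ∑ j, R j * pderiv j g → b * P₂ = ∑ j, T j * pderiv j g →
        macleanForm a b R T ∈ Ideal.span (Set.range fun j => pderiv j g) ⊔ Ideal.span {P₂})
    {G H : MvPolynomial (σ ⊕ τ) K}
    (hG : G ∈ (Ideal.span 𝒢₁).map (rename Sum.inl : MvPolynomial σ K →ₐ[K] MvPolynomial (σ ⊕ τ) K) ⊔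
      (Ideal.span 𝒢₂).map (rename Sum.inr : MvPolynomial τ K →ₐ[K] MvPolynomial (σ ⊕ τ) K))
    (hH : H ∈ (Ideal.span 𝒢₁).map (rename Sum.inl : MvPolynomial σ K →ₐ[K] MvPolynomial (σ ⊕ τ) K) ⊔
      (Ideal.span 𝒢₂).map (rename Sum.inr : MvPolynomial τ K →ₐ[K] MvPolynomial (σ ⊕ τ) K))
    {𝒬 ℛ : σ ⊕ τ → MvPolynomial (σ ⊕ τ) K}
    (h𝒬 : G * (rename Sum.inl P₁ * rename Sum.inr P₂) = ∑ z, 𝒬 z * pderiv z (joinPoly f g))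
    (hℛ : H * (rename Sum.inl P₁ * rename Sum.inr P₂) = ∑ z, ℛ z * pderiv z (joinPoly f g)) :
    macleanForm G H 𝒬 ℛ ∈ Ideal.span (Set.range fun z => pderiv z (joinPoly f g)) ⊔
      Ideal.span {rename Sum.inl P₁ * rename Sum.inr P₂} := by
  classical
  -- abbreviations
  set Jf := Ideal.span (Set.range fun i => pderiv i f) with hJfdef
  set Jg := Ideal.span (Set.range fun j => pderiv j g) with hJgdef
  set JF := Ideal.span (Set.range fun z => pderiv z (joinPoly f g)) with hJFdef
  set P : MvPolynomial (σ ⊕ τ) K := rename Sum.inl P₁ * rename Sum.inr P₂ with hPdef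
  -- Koszul for f, g and f + g
  have hK₁ : HasKoszulSyzygies fun i => pderiv i f := hasKoszulSyzygies_pderiv_of_isArtinianGorenstein hf hd hJf
  have hK₂ : HasKoszulSyzygies fun j => pderiv j g := hasKoszulSyzygies_pderiv_of_isArtinianGorenstein hg hd hJg
  have hKF : HasKoszulSyzygies fun z => pderiv z (joinPoly f g) :=
    hasKoszulSyzygies_pderiv_joinPoly hf hg hd hJf hJg
  obtain ⟨n₁, A₁, a, ha, n₂, A₂, a', ha', rfl⟩ := exists_sum_eq_of_mem_map_span_sup hG
  obtain ⟨m₁, B₁, b, hb, m₂, B₂, b', hb', rfl⟩ := exists_sum_eq_of_mem_map_span_sup hH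
  -- lifts of the generators
  have hl₁ : ∀ x ∈ 𝒢₁, ∃ Q : σ → MvPolynomial σ K, x * P₁ = ∑ i, Q i * pderiv i f := by
    intro x hx
    have hx' : x ∈ Jf.colon {P₁} := h𝒢₁ x hx
    rw [Submodule.mem_colon_singleton, smul_eq_mul] at hx'
    obtain ⟨Q, hQ⟩ := Ideal.mem_span_range_iff_exists_fun.mp hx'
    exact ⟨Q, hQ.symm⟩
  have hl₂ : ∀ y ∈ 𝒢₂, ∃ R : τ → MvPolynomial τ K, y * P₂ = ∑ j, R j * pderiv j g := by
    intro y hy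
    have hy' : y ∈ Jg.colon {P₂} := h𝒢₂ y hy
    rw [Submodule.mem_colon_singleton, smul_eq_mul] at hy'
    obtain ⟨R, hR⟩ := Ideal.mem_span_range_iff_exists_fun.mp hy'
    exact ⟨R, hR.symm⟩
  choose Q hQ using fun k => hl₁ (a k) (ha k)
  choose R hR using fun k => hl₂ (a' k) (ha' k)
  choose S hS using fun l => hl₁ (b l) (hb l)
  choose T hT using fun l => hl₂ (b' l) (hb' l)
  -- the induced lifts of `G` and `H`
  set 𝒬₀ : σ ⊕ τ → MvPolynomial (σ ⊕ τ) K :=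
    ∑ k, liftInl P₂ (A₁ k) (Q k) + ∑ k, liftInr P₁ (A₂ k) (R k) with h𝒬₀
  set ℛ₀ : σ ⊕ τ → MvPolynomial (σ ⊕ τ) K :=
    ∑ l, liftInl P₂ (B₁ l) (S l) + ∑ l, liftInr P₁ (B₂ l) (T l) with hℛ₀
  have h𝒬₀' : (∑ k, A₁ k * rename Sum.inl (a k) + ∑ k, A₂ k * rename Sum.inr (a' k)) * P =
      ∑ z, 𝒬₀ z * pderiv z (joinPoly f g) := by
    rw [h𝒬₀, add_mul]
    simp only [Pi.add_apply, add_mul, Finset.sum_add_distrib]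
    rw [sum_mul_eq_sum_sum_lift Finset.univ (fun k _ => mul_eq_sum_liftInl (hQ k) P₂ (A₁ k)),
      sum_mul_eq_sum_sum_lift Finset.univ (fun k _ => mul_eq_sum_liftInr (hR k) P₁ (A₂ k))]
  have hℛ₀' : (∑ l, B₁ l * rename Sum.inl (b l) + ∑ l, B₂ l * rename Sum.inr (b' l)) * P =
      ∑ z, ℛ₀ z * pderiv z (joinPoly f g) := by
    rw [hℛ₀, add_mul]
    simp only [Pi.add_apply, add_mul, Finset.sum_add_distrib]
    rw [sum_mul_eq_sum_sum_lift Finset.univ (fun l _ => mul_eq_sum_liftInl (hS l) P₂ (B₁ l)),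
      sum_mul_eq_sum_sum_lift Finset.univ (fun l _ => mul_eq_sum_liftInr (hT l) P₁ (B₂ l))]
  -- `q` with the given lifts ≡ `q` with the induced lifts (mod `J^{f+g}`)
  have hindep := macleanForm_sub_macleanForm_mem_of_lifts' hKF h𝒬 h𝒬₀' hℛ hℛ₀'
  -- `q` with the induced lifts: the four blocks
  have hmain : macleanForm (∑ k, A₁ k * rename Sum.inl (a k) + ∑ k, A₂ k * rename Sum.inr (a' k))
      (∑ l, B₁ l * rename Sum.inl (b l) + ∑ l, B₂ l * rename Sum.inr (b' l)) 𝒬₀ ℛ₀ ∈ JF ⊔ Ideal.span {P} := by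
    rw [h𝒬₀, hℛ₀, macleanForm_add_left, macleanForm_add_right, macleanForm_add_right]
    refine Ideal.add_mem _ (Ideal.add_mem _ ?_ ?_) (Ideal.add_mem _ ?_ ?_)
    · -- (x, x)
      rw [macleanForm_sum_left]
      refine Ideal.sum_mem _ fun k _ => ?_
      rw [macleanForm_sum_right]
      refine Ideal.sum_mem _ fun l _ => ?_
      have h1 := macleanForm_inl_inl_sub_mem (g := g)
        (fun i => sub_mem_span_pderiv_of_lifts hK₁ (hQ k) (hS l) i) P₂ (A₁ k) (B₁ l)
      have h2 : A₁ k * B₁ l * rename Sum.inr P₂ * rename Sum.inl (macleanForm (a k) (b l) (Q k) (S l)) ∈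
          JF ⊔ Ideal.span {P} := by
        rw [mul_assoc (A₁ k * B₁ l)]
        exact Ideal.mul_mem_left _ _
          (rename_inr_mul_rename_inl_mem_sup g P₂ (hq₁ _ (ha k) _ (hb l) _ _ (hQ k) (hS l)))
      have e := sub_add_cancel
        (macleanForm (A₁ k * rename Sum.inl (a k)) (B₁ l * rename Sum.inl (b l)) (liftInl P₂ (A₁ k) (Q k))
          (liftInl P₂ (B₁ l) (S l)))
        (A₁ k * B₁ l * rename Sum.inr P₂ * rename Sum.inl (macleanForm (a k) (b l) (Q k) (S l)))
      rw [← e]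
      exact Ideal.add_mem _ (Ideal.mem_sup_left h1) h2
    · -- (x, y)
      rw [macleanForm_sum_left]
      refine Ideal.sum_mem _ fun k _ => ?_
      rw [macleanForm_sum_right]
      exact Ideal.sum_mem _ fun l _ => Ideal.mem_sup_left (macleanForm_inl_inr_mem (hQ k) (hT l) (A₁ k) (B₂ l))
    · -- (y, x)
      rw [macleanForm_sum_left]
      refine Ideal.sum_mem _ fun k _ => ?_
      rw [macleanForm_sum_right]
      exact Ideal.sum_mem _ fun l _ => Ideal.mem_sup_left (macleanForm_inr_inl_mem (hR k) (hS l) (A₂ k) (B₁ l))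
    · -- (y, y)
      rw [macleanForm_sum_left]
      refine Ideal.sum_mem _ fun k _ => ?_
      rw [macleanForm_sum_right]
      refine Ideal.sum_mem _ fun l _ => ?_
      have h1 := macleanForm_inr_inr_sub_mem (f := f)
        (fun j => sub_mem_span_pderiv_of_lifts hK₂ (hR k) (hT l) j) P₁ (A₂ k) (B₂ l)
      have h2 : A₂ k * B₂ l * rename Sum.inl P₁ * rename Sum.inr (macleanForm (a' k) (b' l) (R k) (T l)) ∈
          JF ⊔ Ideal.span {P} := by
        rw [mul_assoc (A₂ k * B₂ l)]
        exact Ideal.mul_mem_left _ _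
          (rename_inl_mul_rename_inr_mem_sup f P₁ (hq₂ _ (ha' k) _ (hb' l) _ _ (hR k) (hT l)))
      have e := sub_add_cancel
        (macleanForm (A₂ k * rename Sum.inr (a' k)) (B₂ l * rename Sum.inr (b' l)) (liftInr P₁ (A₂ k) (R k))
          (liftInr P₁ (B₂ l) (T l)))
        (A₂ k * B₂ l * rename Sum.inl P₁ * rename Sum.inr (macleanForm (a' k) (b' l) (R k) (T l)))
      rw [← e]
      exact Ideal.add_mem _ (Ideal.mem_sup_left h1) h2
  have e := sub_add_cancel
    (macleanForm (∑ k, A₁ k * rename Sum.inl (a k) + ∑ k, A₂ k * rename Sum.inr (a' k))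
      (∑ l, B₁ l * rename Sum.inl (b l) + ∑ l, B₂ l * rename Sum.inr (b' l)) 𝒬 ℛ)
    (macleanForm (∑ k, A₁ k * rename Sum.inl (a k) + ∑ k, A₂ k * rename Sum.inr (a' k))
      (∑ l, B₁ l * rename Sum.inl (b l) + ∑ l, B₂ l * rename Sum.inr (b' l)) 𝒬₀ ℛ₀)
  rw [← e]
  exact Ideal.add_mem _ (Ideal.mem_sup_left hindep) hmain

/-- **Theorem 1.3 (i) [= Thm. 4.1 (i) of arXiv v4], generator form: if `q_1` vanishes on (pairs of) generators of
`J^{f,[Z_1]}` and `q_2` vanishes on (pairs of) generators of `J^{g,[Z_2]}`, then `q` vanishes identically on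
`J^{f+g,[J(Z_1,Z_2)]}`** — "From (eqQFFjoin) we obtain (i) by a direct computation in the generators of
`J^{f+g,[J(Z_1,Z_2)]}` which are generators of either `J^{f,[Z_1]}` or `J^{g,[Z_2]}` (by (eqjoinAGalg))." Precisely:
`f`, `g` forms of degree `d ≥ 2` with Artinian Gorenstein Jacobian ideals; `𝒢_1`, `𝒢_2` generating sets of
`(J^f : P_{Z_1})`, `(J^g : P_{Z_2})`; if `q_1(a,b) ∈ J^f + ⟨P_{Z_1}⟩` for all `a, b ∈ 𝒢_1` and all their lifts, and
likewise for `q_2`, then `q(G,H) ∈ J^{f+g} + ⟨P_{Z_1}P_{Z_2}⟩` for ALL `G, H ∈ (J^{f+g} : P_{Z_1}P_{Z_2})` and ALL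
lifts. (Reading of "vanishes in all degrees": on all pairs of elements; taking for `𝒢_i` the generators of degree
`≤ e` gives the degree-`e` statement for the `G, H` they generate.)
[cite: DuqueFrancoVillaflor2025Join, Theorem 1.3 (i) (= Theorem 4.1 (i) of arXiv v4)] -/
theorem macleanForm_join_mem_of_generators {d s₁ s₂ : ℕ} (hf : f.IsHomogeneous d) (hg : g.IsHomogeneous d)
    (hd : 2 ≤ d) (hJf : IsArtinianGorenstein (Ideal.span (Set.range fun i => pderiv i f)) s₁)
    (hJg : IsArtinianGorenstein (Ideal.span (Set.range fun j => pderiv j g)) s₂)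
    {P₁ : MvPolynomial σ K} {P₂ : MvPolynomial τ K} {𝒢₁ : Set (MvPolynomial σ K)} {𝒢₂ : Set (MvPolynomial τ K)}
    (h𝒢₁ : Ideal.span 𝒢₁ = (Ideal.span (Set.range fun i => pderiv i f)).colon {P₁})
    (h𝒢₂ : Ideal.span 𝒢₂ = (Ideal.span (Set.range fun j => pderiv j g)).colon {P₂})
    (hq₁ : ∀ a ∈ 𝒢₁, ∀ b ∈ 𝒢₁, ∀ Q S : σ → MvPolynomial σ K,
      a * P₁ = ∑ i, Q i * pderiv i f → b * P₁ = ∑ i, S i * pderiv i f →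
        macleanForm a b Q S ∈ Ideal.span (Set.range fun i => pderiv i f) ⊔ Ideal.span {P₁})
    (hq₂ : ∀ a ∈ 𝒢₂, ∀ b ∈ 𝒢₂, ∀ R T : τ → MvPolynomial τ K,
      a * P₂ = ∑ j, R j * pderiv j g → b * P₂ = ∑ j, T j * pderiv j g →
        macleanForm a b R T ∈ Ideal.span (Set.range fun j => pderiv j g) ⊔ Ideal.span {P₂})
    {G H : MvPolynomial (σ ⊕ τ) K}
    (hG : G ∈ (Ideal.span (Set.range fun z => pderiv z (joinPoly f g))).colon
      {rename Sum.inl P₁ * rename Sum.inr P₂})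
    (hH : H ∈ (Ideal.span (Set.range fun z => pderiv z (joinPoly f g))).colon
      {rename Sum.inl P₁ * rename Sum.inr P₂})
    {𝒬 ℛ : σ ⊕ τ → MvPolynomial (σ ⊕ τ) K}
    (h𝒬 : G * (rename Sum.inl P₁ * rename Sum.inr P₂) = ∑ z, 𝒬 z * pderiv z (joinPoly f g))
    (hℛ : H * (rename Sum.inl P₁ * rename Sum.inr P₂) = ∑ z, ℛ z * pderiv z (joinPoly f g)) :
    macleanForm G H 𝒬 ℛ ∈ Ideal.span (Set.range fun z => pderiv z (joinPoly f g)) ⊔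
      Ideal.span {rename Sum.inl P₁ * rename Sum.inr P₂} := by
  have hcolon : (Ideal.span (Set.range fun z => pderiv z (joinPoly f g))).colon
      {rename Sum.inl P₁ * rename Sum.inr P₂} =
      (Ideal.span 𝒢₁).map (rename Sum.inl : MvPolynomial σ K →ₐ[K] MvPolynomial (σ ⊕ τ) K) ⊔
        (Ideal.span 𝒢₂).map (rename Sum.inr : MvPolynomial τ K →ₐ[K] MvPolynomial (σ ⊕ τ) K) := by
    rw [span_pderiv_joinPoly, hJf.colon_join hJg, h𝒢₁, h𝒢₂]
  rw [hcolon] at hG hH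
  exact macleanForm_join_mem_of_mem_span hf hg hd hJf hJg
    (fun a ha => by rw [← h𝒢₁]; exact Ideal.subset_span ha)
    (fun b hb => by rw [← h𝒢₂]; exact Ideal.subset_span hb) hq₁ hq₂ hG hH h𝒬 hℛ

/-! ### Theorem 1.3 (i) in degree `e` from vanishing in degrees `≤ e` -/

omit [Fintype σ] in
/-- The components of `c · a` below the degree of the form `a` vanish. [folklore] -/
private theorem homogeneousComponent_mul_eq_zero_of_lt {a : MvPolynomial σ K} {n e : ℕ}
    (ha : a.IsHomogeneous n) (he : e < n) (c : MvPolynomial σ K) : homogeneousComponent e (c * a) = 0 := by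
  classical
  conv_lhs => rw [← sum_homogeneousComponent c, Finset.sum_mul, map_sum]
  refine Finset.sum_eq_zero fun k _ => ?_
  have hmem : homogeneousComponent k c * a ∈ homogeneousSubmodule σ K (k + n) :=
    (homogeneousComponent_isHomogeneous k c).mul ha
  rw [homogeneousComponent_of_mem hmem, if_neg (by omega)]

omit [Fintype σ] in
/-- **Forms of degree `e` in an ideal with homogeneous generators are generated by the generators of degree
`≤ e`** (take degree-`e` components of a combination: `(Σ c_k a_k)_e = Σ_{deg a_k ≤ e} (c_k)_{e − deg a_k} a_k`).
[folklore; cf. [cite: DuqueFrancoVillaflor2025Join, Theorem 1.3 (i)]] -/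
theorem mem_span_sep_of_isHomogeneous {𝒢 : Set (MvPolynomial σ K)} (h𝒢 : ∀ a ∈ 𝒢, ∃ n, a.IsHomogeneous n)
    {G : MvPolynomial σ K} {e : ℕ} (hG : G.IsHomogeneous e) (hmem : G ∈ Ideal.span 𝒢) :
    G ∈ Ideal.span {a ∈ 𝒢 | ∃ n ≤ e, a.IsHomogeneous n} := by
  classical
  obtain ⟨m, c, x, rfl⟩ := Submodule.mem_span_set'.mp hmem
  choose n hn using fun k => h𝒢 (x k : MvPolynomial σ K) (x k).2
  rw [← homogeneousComponent_eq_self hG, map_sum]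
  refine Ideal.sum_mem _ fun k _ => ?_
  rw [smul_eq_mul]
  by_cases hk : n k ≤ e
  · obtain ⟨t, ht⟩ : ∃ t, e = t + n k := ⟨e - n k, by omega⟩
    rw [ht, mul_comm, homogeneousComponent_mul_add_of_isHomogeneous (hn k), mul_comm]
    exact Ideal.mul_mem_left _ _ (Ideal.subset_span ⟨(x k).2, n k, by omega, hn k⟩)
  · rw [homogeneousComponent_mul_eq_zero_of_lt (hn k) (by omega)]
    exact zero_mem _

/-- **Theorem 1.3 (i) [= Thm. 4.1 (i) of arXiv v4] in degree `e`: "If `q_1` and `q_2` vanish in all degrees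
`ℓ ≤ e`, then `q` vanishes in degree `e`"** — in the generator-pair form: `f`, `g` forms of degree `d ≥ 2` with
Artinian Gorenstein Jacobian ideals; `𝒢_1`, `𝒢_2` HOMOGENEOUS generating sets of `(J^f : P_{Z_1})`,
`(J^g : P_{Z_2})`; if `q_1(a,b) ∈ J^f + ⟨P_{Z_1}⟩` for all pairs of generators `a, b ∈ 𝒢_1` of degrees `≤ e`
(all lifts; the two degrees may differ) and likewise for `q_2`, then `q(G,H) ∈ J^{f+g} + ⟨P_{Z_1}P_{Z_2}⟩` for
all FORMS `G, H` of degree `e` in `(J^{f+g} : P_{Z_1}P_{Z_2})` and all lifts. Proof: by (eqjoinAGalg) and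
`mem_span_sep_of_isHomogeneous`, a form of degree `e` in `(J^{f+g} : P_{Z_1}P_{Z_2}) = ⟨𝒢_1(x)⟩ + ⟨𝒢_2(y)⟩`
lies in the ideal generated by the generators of degree `≤ e`; then `macleanForm_join_mem_of_mem_span`.
[cite: DuqueFrancoVillaflor2025Join, Theorem 1.3 (i) (= Theorem 4.1 (i) of arXiv v4)] -/
theorem macleanForm_join_mem_of_generators_of_degree_le {d s₁ s₂ : ℕ} (hf : f.IsHomogeneous d)
    (hg : g.IsHomogeneous d) (hd : 2 ≤ d)
    (hJf : IsArtinianGorenstein (Ideal.span (Set.range fun i => pderiv i f)) s₁)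
    (hJg : IsArtinianGorenstein (Ideal.span (Set.range fun j => pderiv j g)) s₂)
    {P₁ : MvPolynomial σ K} {P₂ : MvPolynomial τ K} {𝒢₁ : Set (MvPolynomial σ K)} {𝒢₂ : Set (MvPolynomial τ K)}
    (h𝒢₁ : Ideal.span 𝒢₁ = (Ideal.span (Set.range fun i => pderiv i f)).colon {P₁})
    (h𝒢₂ : Ideal.span 𝒢₂ = (Ideal.span (Set.range fun j => pderiv j g)).colon {P₂})
    (h𝒢₁h : ∀ a ∈ 𝒢₁, ∃ n, a.IsHomogeneous n) (h𝒢₂h : ∀ b ∈ 𝒢₂, ∃ n, b.IsHomogeneous n) {e : ℕ}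
    (hq₁ : ∀ a ∈ 𝒢₁, ∀ b ∈ 𝒢₁, (∃ n ≤ e, a.IsHomogeneous n) → (∃ n ≤ e, b.IsHomogeneous n) →
      ∀ Q S : σ → MvPolynomial σ K, a * P₁ = ∑ i, Q i * pderiv i f → b * P₁ = ∑ i, S i * pderiv i f →
        macleanForm a b Q S ∈ Ideal.span (Set.range fun i => pderiv i f) ⊔ Ideal.span {P₁})
    (hq₂ : ∀ a ∈ 𝒢₂, ∀ b ∈ 𝒢₂, (∃ n ≤ e, a.IsHomogeneous n) → (∃ n ≤ e, b.IsHomogeneous n) →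
      ∀ R T : τ → MvPolynomial τ K, a * P₂ = ∑ j, R j * pderiv j g → b * P₂ = ∑ j, T j * pderiv j g →
        macleanForm a b R T ∈ Ideal.span (Set.range fun j => pderiv j g) ⊔ Ideal.span {P₂})
    {G H : MvPolynomial (σ ⊕ τ) K} (hGe : G.IsHomogeneous e) (hHe : H.IsHomogeneous e)
    (hG : G ∈ (Ideal.span (Set.range fun z => pderiv z (joinPoly f g))).colon
      {rename Sum.inl P₁ * rename Sum.inr P₂})
    (hH : H ∈ (Ideal.span (Set.range fun z => pderiv z (joinPoly f g))).colon
      {rename Sum.inl P₁ * rename Sum.inr P₂})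
    {𝒬 ℛ : σ ⊕ τ → MvPolynomial (σ ⊕ τ) K}
    (h𝒬 : G * (rename Sum.inl P₁ * rename Sum.inr P₂) = ∑ z, 𝒬 z * pderiv z (joinPoly f g))
    (hℛ : H * (rename Sum.inl P₁ * rename Sum.inr P₂) = ∑ z, ℛ z * pderiv z (joinPoly f g)) :
    macleanForm G H 𝒬 ℛ ∈ Ideal.span (Set.range fun z => pderiv z (joinPoly f g)) ⊔
      Ideal.span {rename Sum.inl P₁ * rename Sum.inr P₂} := by
  classical
  -- the generators of degree `≤ e`
  set 𝒢₁' : Set (MvPolynomial σ K) := {a ∈ 𝒢₁ | ∃ n ≤ e, a.IsHomogeneous n} with h𝒢₁'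
  set 𝒢₂' : Set (MvPolynomial τ K) := {b ∈ 𝒢₂ | ∃ n ≤ e, b.IsHomogeneous n} with h𝒢₂'
  -- Thm 1.1: `(J^{f+g} : P_{Z_1}P_{Z_2}) = ⟨𝒢_1(x) ∪ 𝒢_2(y)⟩`, a homogeneous generating set
  have hcolon : (Ideal.span (Set.range fun z => pderiv z (joinPoly f g))).colon
      {rename Sum.inl P₁ * rename Sum.inr P₂} =
      Ideal.span ((rename Sum.inl : MvPolynomial σ K →ₐ[K] MvPolynomial (σ ⊕ τ) K) '' 𝒢₁ ∪
        (rename Sum.inr : MvPolynomial τ K →ₐ[K] MvPolynomial (σ ⊕ τ) K) '' 𝒢₂) := by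
    rw [span_pderiv_joinPoly, hJf.colon_join hJg, ← h𝒢₁, ← h𝒢₂, Ideal.map_span, Ideal.map_span,
      Ideal.span_union]
  have hhom : ∀ x ∈ (rename Sum.inl : MvPolynomial σ K →ₐ[K] MvPolynomial (σ ⊕ τ) K) '' 𝒢₁ ∪
      (rename Sum.inr : MvPolynomial τ K →ₐ[K] MvPolynomial (σ ⊕ τ) K) '' 𝒢₂, ∃ n, x.IsHomogeneous n := by
    rintro x (⟨a, ha, rfl⟩ | ⟨b, hb, rfl⟩)
    · obtain ⟨n, hn⟩ := h𝒢₁h a ha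
      exact ⟨n, hn.rename_isHomogeneous⟩
    · obtain ⟨n, hn⟩ := h𝒢₂h b hb
      exact ⟨n, hn.rename_isHomogeneous⟩
  -- its members of degree `≤ e` come from `𝒢_1'`, `𝒢_2'`
  have hsub : {x ∈ (rename Sum.inl : MvPolynomial σ K →ₐ[K] MvPolynomial (σ ⊕ τ) K) '' 𝒢₁ ∪
      (rename Sum.inr : MvPolynomial τ K →ₐ[K] MvPolynomial (σ ⊕ τ) K) '' 𝒢₂ | ∃ n ≤ e, x.IsHomogeneous n} ⊆
      (rename Sum.inl : MvPolynomial σ K →ₐ[K] MvPolynomial (σ ⊕ τ) K) '' 𝒢₁' ∪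
        (rename Sum.inr : MvPolynomial τ K →ₐ[K] MvPolynomial (σ ⊕ τ) K) '' 𝒢₂' := by
    rintro x ⟨(⟨a, ha, rfl⟩ | ⟨b, hb, rfl⟩), n, hn, hx⟩
    · exact Or.inl ⟨a, ⟨ha, n, hn, (IsHomogeneous.rename_isHomogeneous_iff Sum.inl_injective).mp hx⟩, rfl⟩
    · exact Or.inr ⟨b, ⟨hb, n, hn, (IsHomogeneous.rename_isHomogeneous_iff Sum.inr_injective).mp hx⟩, rfl⟩
  -- so forms of degree `e` in the colon ideal lie in `⟨𝒢_1'(x)⟩ + ⟨𝒢_2'(y)⟩`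
  have hbdd : ∀ {X : MvPolynomial (σ ⊕ τ) K}, X.IsHomogeneous e →
      X ∈ (Ideal.span (Set.range fun z => pderiv z (joinPoly f g))).colon
        {rename Sum.inl P₁ * rename Sum.inr P₂} →
      X ∈ (Ideal.span 𝒢₁').map (rename Sum.inl : MvPolynomial σ K →ₐ[K] MvPolynomial (σ ⊕ τ) K) ⊔
        (Ideal.span 𝒢₂').map (rename Sum.inr : MvPolynomial τ K →ₐ[K] MvPolynomial (σ ⊕ τ) K) := by
    intro X hXe hX
    rw [hcolon] at hX
    rw [Ideal.map_span, Ideal.map_span, ← Ideal.span_union]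
    exact Ideal.span_mono hsub (mem_span_sep_of_isHomogeneous hhom hXe hX)
  refine macleanForm_join_mem_of_mem_span hf hg hd hJf hJg (𝒢₁ := 𝒢₁') (𝒢₂ := 𝒢₂') ?_ ?_ ?_ ?_
    (hbdd hGe hG) (hbdd hHe hH) h𝒬 hℛ
  · intro a ha
    rw [← h𝒢₁]
    exact Ideal.subset_span ha.1
  · intro b hb
    rw [← h𝒢₂]
    exact Ideal.subset_span hb.1
  · exact fun a ha b hb => hq₁ a ha.1 b hb.1 ha.2 hb.2
  · exact fun a ha b hb => hq₂ a ha.1 b hb.1 ha.2 hb.2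

end Vanishing

end Literature.AlgebraicGeometry.DuqueFrancoVillaflor2025

end
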